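import Summits.AtomisticToContinuum.Crystallization.Theses.ThreeConeCertificate
import Summits.AtomisticToContinuum.Crystallization.Theorems.SlackRigidity.Negative.WitnessBasics
import Literature.MathematicalPhysics.StatisticalMechanics.BarlowStacking
import Literature.MathematicalPhysics.StatisticalMechanics.BarlowCoordination
import Literature.MathematicalPhysics.StatisticalMechanics.BarlowRings
import Literature.MathematicalPhysics.StatisticalMechanics.HaggStacking

/-!
# drefute gen-2 evidence for line `c-layer-witness-strictness` (crux `SlackRigidity`,
stmt-AtomisticToContinuum-11960): PROOF of `stub_layeringOffIdeal` (Stub 5a of the skeleton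
`Cruxes/SlackRigidity/Lines/c-layer-witness-strictness.lean`, verbatim signature, see
`stub_layeringOffIdeal_proof` at the end; sorry-free).

Seat `refuter-drefute-stmt-AtomisticToContinuum-11960-g2-0`, 2026-08-16.  The proof is the
"metric" layer-propagation argument (gen-1 drefute notes §5 / lead's vetting), organised as:

* § Lattice coordinates — `lc a p q z = p u + q v + z e₃`, `dist_lc_sq`, `barlowPos_eq_lc`.
* § Star — `barlowStacking_inter_closedBall`: on the window `0.775 a < h < 0.894 a` the
  `6a/5`-ball of a Barlow stacking about `0` is the explicit 13-point `starSet a h (s 0) (−s (−1))`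
  (centre, hexagon, upper/lower hole triples; integer shell lemmas of `BarlowCoordination/Rings`).
* § Forms — `circumcentre`: a point at the adjacent-layer distance from `0, y, y'` (adjacent
  hexagon points) sits over the centroid `(y + y')/3` at height `±h`; hole classes `hclass`.
* § Image — `image_starSet`: a linear isometry mapping the hexagon onto itself maps a standard
  star to a standard star (classes/heights sorted by the distance table; `h > 0.775 a`).
* § Propagation — `base_layer`: a standard star at the root forces the whole layer lattice `Λ₀`
  into `Y` (ℤ²-induction; three known neighbours + central symmetry + a counting step), using the
  OFF-IDEAL hypothesis `h² ≠ 2a²/3` exactly once (`mem_hexagon_of_norm_eq`: norm-`a` star points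
  are hexagon points).
* § OneLayer — `one_layer`: all stars on an occupied layer are standard with CONSTANT classes;
  `slab`: the slab of height `h` is exhausted by three layers (covering radius² `7a²/16`).
* § Main — occupied labelled layers `Occ`, the letter sequence `haggOf` read off `Y`, label
  uniqueness mod 3 (`no_hole_offset`), ℤ-induction `occ_haggLabel`, `eq_barlowStacking`, and the
  WLOG standardisation by `LinearIsometry.toLinearIsometryEquiv`.
-/

noncomputable section

open scoped BigOperators
open Set Metric

namespace Summit.AtomisticToContinuum.Crystallization.Cruxes.SlackRigidity.DrefuteLayering

open Literature.MathematicalPhysics.StatisticalMechanics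

/-- `ℝ³`. [folklore] -/
abbrev E3 := EuclideanSpace ℝ (Fin 3)

/-! ## Lattice coordinates -/

/-- The point `p u + q v + z e₃` (`u = (a,0,0)`, `v = (a/2, a√3/2, 0)`). [folklore] -/
def lc (a p q z : ℝ) : E3 := !₂[a * (p + q / 2), a * √3 / 2 * q, z]

@[simp] theorem lc_apply_zero (a p q z : ℝ) : lc a p q z 0 = a * (p + q / 2) := by simp [lc]
@[simp] theorem lc_apply_one (a p q z : ℝ) : lc a p q z 1 = a * √3 / 2 * q := by simp [lc]
@[simp] theorem lc_apply_two (a p q z : ℝ) : lc a p q z 2 = z := by simp [lc]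

/-- Squared distance in lattice coordinates. [folklore] -/
theorem dist_lc_sq (a p q z p' q' z' : ℝ) :
    dist (lc a p q z) (lc a p' q' z') ^ 2 =
      a ^ 2 * ((p - p') ^ 2 + (p - p') * (q - q') + (q - q') ^ 2) + (z - z') ^ 2 := by
  rw [EuclideanSpace.dist_sq_eq, Fin.sum_univ_three, Real.dist_eq, Real.dist_eq, Real.dist_eq,
    sq_abs, sq_abs, sq_abs, lc_apply_zero, lc_apply_zero, lc_apply_one, lc_apply_one,
    lc_apply_two, lc_apply_two]
  have h3 : (√3 : ℝ) ^ 2 = 3 := Real.sq_sqrt (by norm_num)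
  linear_combination (a ^ 2 * (q - q') ^ 2 / 4) * h3

@[simp] theorem lc_zero (a : ℝ) : lc a 0 0 0 = 0 := by
  ext l; fin_cases l <;> simp [lc]

/-- Squared norm in lattice coordinates. [folklore] -/
theorem norm_lc_sq (a p q z : ℝ) :
    ‖lc a p q z‖ ^ 2 = a ^ 2 * (p ^ 2 + p * q + q ^ 2) + z ^ 2 := by
  rw [← dist_zero_right, ← lc_zero a, dist_lc_sq]
  ring

/-- Two lattice-coordinate points are equal iff their coordinates are (`a ≠ 0`). [folklore] -/
theorem lc_eq_lc_iff {a : ℝ} (ha : a ≠ 0) (p q z p' q' z' : ℝ) :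
    lc a p q z = lc a p' q' z' ↔ p = p' ∧ q = q' ∧ z = z' := by
  constructor
  · intro h
    have h0 := congrArg (fun x : E3 => x 0) h
    have h1 := congrArg (fun x : E3 => x 1) h
    have h2 := congrArg (fun x : E3 => x 2) h
    simp only [lc_apply_zero, lc_apply_one, lc_apply_two] at h0 h1 h2
    have hs : (0 : ℝ) < √3 := Real.sqrt_pos.2 (by norm_num)
    have hc : a * √3 / 2 ≠ 0 := by positivity
    have hq : q = q' := mul_left_cancel₀ hc h1
    refine ⟨?_, hq, h2⟩
    have := mul_left_cancel₀ ha h0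
    linarith
  · rintro ⟨rfl, rfl, rfl⟩; rfl

/-- Translation in lattice coordinates. [folklore] -/
theorem lc_add_lc (a p q z p' q' z' : ℝ) :
    lc a p q z + lc a p' q' z' = lc a (p + p') (q + q') (z + z') := by
  ext l; fin_cases l <;> simp [lc] <;> ring

theorem lc_sub_lc (a p q z p' q' z' : ℝ) :
    lc a p q z - lc a p' q' z' = lc a (p - p') (q - q') (z - z') := by
  ext l; fin_cases l <;> simp [lc] <;> ring

theorem neg_lc (a p q z : ℝ) : -lc a p q z = lc a (-p) (-q) (-z) := by
  ext l; fin_cases l <;> (simp [lc]; try ring)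

theorem smul_lc (a c p q z : ℝ) : c • lc a p q z = lc a (c * p) (c * q) (c * z) := by
  ext l; fin_cases l <;> simp [lc] <;> ring

/-- `barlowPos` in lattice coordinates. [folklore] -/
theorem barlowPos_eq_lc (a h : ℝ) (s : ℤ → ℤ) (k i j : ℤ) :
    barlowPos a h s k i j =
      lc a (i + haggLabel s k / 3) (j + haggLabel s k / 3) (k * h) := by
  ext l
  fin_cases l <;> (simp [lc, -mul_eq_mul_left_iff]; try ring)

/-- `12 ‖barlowPos‖² = a² (3(2i+j+L)² + (3j+L)²) + 12 k² h²`. [folklore] -/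
theorem twelve_mul_norm_barlowPos_sq (a h : ℝ) (s : ℤ → ℤ) (k i j : ℤ) :
    12 * ‖barlowPos a h s k i j‖ ^ 2 =
      a ^ 2 * ((3 * (2 * i + j + haggLabel s k) ^ 2 + (3 * j + haggLabel s k) ^ 2 : ℤ) : ℝ) +
        12 * ((k : ℝ) * h) ^ 2 := by
  rw [barlowPos_eq_lc, norm_lc_sq]
  push_cast
  ring

/-! ## The explicit `6a/5`-star -/

/-- The six in-plane neighbour vectors `±u, ±v, ±(u − v)`. [folklore] -/
def hexagon (a : ℝ) : Set E3 :=
  {lc a 1 0 0, lc a (-1) 0 0, lc a 0 1 0, lc a 0 (-1) 0, lc a 1 (-1) 0, lc a (-1) 1 0}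

/-- The hole triple of class `τ = ±1` at height `z`: `τ • {w, w − u, w − v} + z e₃`
(`w = (u+v)/3`). [folklore] -/
def holes (a : ℝ) (τ : ℤ) (z : ℝ) : Set E3 :=
  {lc a (τ / 3) (τ / 3) z, lc a (τ / 3 - τ) (τ / 3) z, lc a (τ / 3) (τ / 3 - τ) z}

/-- The standard 13-point star: centre, hexagon, upper hole triple of class `τ`, lower hole triple
of class `τ'`. [folklore] -/
def starSet (a h : ℝ) (τ τ' : ℤ) : Set E3 :=
  {0} ∪ hexagon a ∪ holes a τ h ∪ holes a τ' (-h)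

section Star

variable {a h : ℝ} {s : ℤ → ℤ} {τ τ' : ℤ}

theorem haggLabel_one (s : ℤ → ℤ) : haggLabel s 1 = s 0 := by
  have := haggLabel_succ s 0
  simpa using this

theorem haggLabel_neg_one (s : ℤ → ℤ) : haggLabel s (-1) = -s (-1) := by
  have := haggLabel_succ s (-1)
  simp at this
  linarith

theorem barlowPos_layer_zero (a h : ℝ) (s : ℤ → ℤ) (i j : ℤ) :
    barlowPos a h s 0 i j = lc a i j 0 := by
  rw [barlowPos_eq_lc]; simp

theorem barlowPos_layer_one (a h : ℝ) (s : ℤ → ℤ) (i j : ℤ) :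
    barlowPos a h s 1 i j = lc a (i + s 0 / 3) (j + s 0 / 3) h := by
  rw [barlowPos_eq_lc, haggLabel_one]; simp

theorem barlowPos_layer_neg_one (a h : ℝ) (s : ℤ → ℤ) (i j : ℤ) :
    barlowPos a h s (-1) i j = lc a (i - s (-1) / 3) (j - s (-1) / 3) (-h) := by
  rw [barlowPos_eq_lc, haggLabel_neg_one]
  push_cast
  congr 1 <;> ring

theorem zero_mem_starSet (a h : ℝ) (τ τ' : ℤ) : (0 : E3) ∈ starSet a h τ τ' := by
  simp [starSet]

theorem mem_starSet_of_mem_hexagon {z : E3} (hz : z ∈ hexagon a) : z ∈ starSet a h τ τ' :=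
  Set.mem_union_left _ (Set.mem_union_left _ (Set.mem_union_right _ hz))

theorem mem_starSet_up {z : E3} (hz : z ∈ holes a τ h) : z ∈ starSet a h τ τ' :=
  Set.mem_union_left _ (Set.mem_union_right _ hz)

theorem mem_starSet_dn {z : E3} (hz : z ∈ holes a τ' (-h)) : z ∈ starSet a h τ τ' :=
  Set.mem_union_right _ hz

theorem mem_starSet_iff {z : E3} : z ∈ starSet a h τ τ' ↔
    z = 0 ∨ z ∈ hexagon a ∨ z ∈ holes a τ h ∨ z ∈ holes a τ' (-h) := by
  simp only [starSet, Set.mem_union, Set.mem_singleton_iff, or_assoc]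

theorem mem_hexagon_iff {z : E3} : z ∈ hexagon a ↔
    z = lc a 1 0 0 ∨ z = lc a (-1) 0 0 ∨ z = lc a 0 1 0 ∨ z = lc a 0 (-1) 0 ∨
      z = lc a 1 (-1) 0 ∨ z = lc a (-1) 1 0 := by
  simp only [hexagon, Set.mem_insert_iff, Set.mem_singleton_iff]

theorem mem_holes_iff {z : E3} {zz : ℝ} : z ∈ holes a τ zz ↔
    z = lc a (τ / 3) (τ / 3) zz ∨ z = lc a (τ / 3 - τ) (τ / 3) zz ∨ z = lc a (τ / 3) (τ / 3 - τ) zz := by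
  simp only [holes, Set.mem_insert_iff, Set.mem_singleton_iff]

/-- Integer squares: `k² ≤ 1` or `4 ≤ k²`. [folklore] -/
theorem sq_le_one_or_four_le (k : ℤ) : k ^ 2 ≤ 1 ∨ 4 ≤ k ^ 2 := by
  rcases le_or_gt k (-2) with h | h
  · right
    nlinarith [mul_nonneg (by linarith : (0 : ℤ) ≤ -k - 2) (by linarith : (0 : ℤ) ≤ -k + 2)]
  rcases le_or_gt 2 k with h' | h'
  · right
    nlinarith [mul_nonneg (by linarith : (0 : ℤ) ≤ k - 2) (by linarith : (0 : ℤ) ≤ k + 2)]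
  · left
    interval_cases k <;> norm_num

/-- The adjacent-layer form is `4` once it is `< 16`. [folklore] -/
theorem adjLayer_eq_four_of_lt {P Q σ : ℤ} (hσ : σ = 1 ∨ σ = -1)
    (hlt : 3 * (2 * P + Q + σ) ^ 2 + (3 * Q + σ) ^ 2 < 16) :
    3 * (2 * P + Q + σ) ^ 2 + (3 * Q + σ) ^ 2 = 4 := by
  rcases adjLayer_eq_four_or_sixteen_le (P := P) (Q := Q) hσ with h4 | h16
  · exact h4
  · omega

/-- **The star of a relaxed Barlow stacking (⊆)**: on the window `0.775a < h < 0.894a`, a point of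
`barlowStacking a h s` of norm `≤ 6a/5` is the centre, one of the six in-plane neighbours, or one of
the `3 + 3` adjacent-layer neighbours. [folklore] -/
theorem mem_starSet_of_mem (hs : IsHaggSeq s) (ha : 0 < a) (hw1 : 0.775 * a < h)
    {z : E3} (hz : z ∈ barlowStacking a h s) (hzn : ‖z‖ ≤ 6 * a / 5) :
    z ∈ starSet a h (s 0) (-s (-1)) := by
  obtain ⟨k, i, j, rfl⟩ := hz
  have hform := twelve_mul_norm_barlowPos_sq a h s k i j
  have hn2 : ‖barlowPos a h s k i j‖ ^ 2 ≤ (6 * a / 5) ^ 2 :=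
    pow_le_pow_left₀ (norm_nonneg _) hzn 2
  have hh0 : 0 < h := by linarith
  have hh2 : 0.6 * a ^ 2 < h ^ 2 := by nlinarith
  have ha2 : 0 < a ^ 2 := by positivity
  have hF0 : (0 : ℤ) ≤ 3 * (2 * i + j + haggLabel s k) ^ 2 + (3 * j + haggLabel s k) ^ 2 := by
    positivity
  have hF0' : (0 : ℝ) ≤
      ((3 * (2 * i + j + haggLabel s k) ^ 2 + (3 * j + haggLabel s k) ^ 2 : ℤ) : ℝ) := by
    exact_mod_cast hF0
  -- the layer index is -1, 0 or 1
  have hk : k ^ 2 ≤ 1 := by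
    rcases sq_le_one_or_four_le k with hk | hk
    · exact hk
    · exfalso
      have hk4 : (4 : ℝ) ≤ (k : ℝ) ^ 2 := by exact_mod_cast hk
      have hkh : 4 * h ^ 2 ≤ (k : ℝ) ^ 2 * h ^ 2 := by nlinarith [sq_nonneg h]
      have h12 : 12 * ((k : ℝ) * h) ^ 2 ≤ 12 * (6 * a / 5) ^ 2 := by nlinarith
      nlinarith
  obtain ⟨hk1, hk2⟩ := abs_le_one_of_sq_le_one hk
  have hk3 : k = -1 ∨ k = 0 ∨ k = 1 := by omega
  -- the form is `< 18`, and `< 16 · a²`-worth once a layer term `12 h² > 7.2 a²` is present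
  have hbound : a ^ 2 * ((3 * (2 * i + j + haggLabel s k) ^ 2 + (3 * j + haggLabel s k) ^ 2 : ℤ) : ℝ)
      + 12 * ((k : ℝ) * h) ^ 2 ≤ 12 * (6 * a / 5) ^ 2 := by rw [← hform]; nlinarith
  rcases hk3 with rfl | rfl | rfl
  · -- k = -1 : lower hole triple, label `L(-1) = -s(-1)`
    have hL := haggLabel_neg_one s
    rw [hL] at hbound
    have hσ : (-s (-1)) = 1 ∨ (-s (-1)) = -1 := by
      rcases hs (-1) with h1 | h1 <;> simp [h1]
    have hlt : 3 * (2 * i + j + -s (-1)) ^ 2 + (3 * j + -s (-1)) ^ 2 < 16 := by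
      have : ((3 * (2 * i + j + -s (-1)) ^ 2 + (3 * j + -s (-1)) ^ 2 : ℤ) : ℝ) < 16 := by
        push_cast at hbound ⊢
        nlinarith
      exact_mod_cast this
    have hF := adjLayer_eq_four_of_lt hσ hlt
    apply mem_starSet_dn
    rw [mem_holes_iff, barlowPos_layer_neg_one, lc_eq_lc_iff ha.ne', lc_eq_lc_iff ha.ne',
      lc_eq_lc_iff ha.ne']
    rcases hs (-1) with h1 | h1 <;> rw [h1] at hF ⊢ <;> push_cast
    · -- s(-1) = 1 : label -1, solutions (0,0), (1,0), (0,1)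
      have hF' : 3 * (2 * i + j + -1) ^ 2 + (3 * j + -1) ^ 2 = 4 := by simpa using hF
      rcases (adjLayer_neg_eq_four_iff i j).1 hF' with ⟨rfl, rfl⟩ | ⟨rfl, rfl⟩ | ⟨rfl, rfl⟩
      · left; push_cast; norm_num
      · right; left; push_cast; norm_num
      · right; right; push_cast; norm_num
    · -- s(-1) = -1 : label 1, solutions (0,0), (-1,0), (0,-1)
      have hF' : 3 * (2 * i + j + 1) ^ 2 + (3 * j + 1) ^ 2 = 4 := by simpa using hF
      rcases (adjLayer_pos_eq_four_iff i j).1 hF' with ⟨rfl, rfl⟩ | ⟨rfl, rfl⟩ | ⟨rfl, rfl⟩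
      · left; push_cast; norm_num
      · right; left; push_cast; norm_num
      · right; right; push_cast; norm_num
  · -- k = 0 : centre or hexagon
    simp only [haggLabel_zero, add_zero, Int.cast_zero, zero_mul] at hbound
    have hlt : 3 * (2 * i + j) ^ 2 + (3 * j) ^ 2 < 18 := by
      have : ((3 * (2 * i + j) ^ 2 + (3 * j) ^ 2 : ℤ) : ℝ) < 18 := by
        push_cast at hbound ⊢
        nlinarith
      exact_mod_cast this
    have hm : i ^ 2 + i * j + j ^ 2 ≤ 1 := by nlinarith
    by_cases hij : i = 0 ∧ j = 0
    · obtain ⟨rfl, rfl⟩ := hij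
      rw [barlowPos_layer_zero]
      simpa using zero_mem_starSet a h (s 0) (-s (-1))
    · have hne : (i, j) ≠ (0 : ℤ × ℤ) := by
        intro h0; apply hij; simpa [Prod.ext_iff] using h0
      have h1 := one_le_sq_add_mul_add_sq hne
      have h12 : 3 * (2 * i + j) ^ 2 + (3 * j) ^ 2 = 12 := by nlinarith
      apply mem_starSet_of_mem_hexagon
      rw [mem_hexagon_iff, barlowPos_layer_zero]
      simp only [lc_eq_lc_iff ha.ne']
      rcases (inLayer_eq_twelve_iff i j).1 h12 with
        ⟨rfl, rfl⟩ | ⟨rfl, rfl⟩ | ⟨rfl, rfl⟩ | ⟨rfl, rfl⟩ | ⟨rfl, rfl⟩ | ⟨rfl, rfl⟩ <;>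
        push_cast <;> norm_num
  · -- k = 1 : upper hole triple, label `L(1) = s 0`
    have hL := haggLabel_one s
    rw [hL] at hbound
    have hσ : s 0 = 1 ∨ s 0 = -1 := hs 0
    have hlt : 3 * (2 * i + j + s 0) ^ 2 + (3 * j + s 0) ^ 2 < 16 := by
      have : ((3 * (2 * i + j + s 0) ^ 2 + (3 * j + s 0) ^ 2 : ℤ) : ℝ) < 16 := by
        push_cast at hbound ⊢
        nlinarith
      exact_mod_cast this
    have hF := adjLayer_eq_four_of_lt hσ hlt
    apply mem_starSet_up
    rw [mem_holes_iff, barlowPos_layer_one, lc_eq_lc_iff ha.ne', lc_eq_lc_iff ha.ne',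
      lc_eq_lc_iff ha.ne']
    rcases hs 0 with h1 | h1 <;> rw [h1] at hF ⊢ <;> push_cast
    · rcases (adjLayer_pos_eq_four_iff i j).1 hF with ⟨rfl, rfl⟩ | ⟨rfl, rfl⟩ | ⟨rfl, rfl⟩
      · left; push_cast; norm_num
      · right; left; push_cast; norm_num
      · right; right; push_cast; norm_num
    · have hF' : 3 * (2 * i + j + -1) ^ 2 + (3 * j + -1) ^ 2 = 4 := by simpa using hF
      rcases (adjLayer_neg_eq_four_iff i j).1 hF' with ⟨rfl, rfl⟩ | ⟨rfl, rfl⟩ | ⟨rfl, rfl⟩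
      · left; push_cast; norm_num
      · right; left; push_cast; norm_num
      · right; right; push_cast; norm_num

/-- **The star of a relaxed Barlow stacking (⊇)**: the 13 standard points are points of the stacking
of norm `≤ 6a/5` (uses `h < 0.894 a`). [folklore] -/
theorem mem_and_norm_le_of_mem_starSet (hs : IsHaggSeq s) (ha : 0 < a) (hh : 0 < h)
    (hw2 : h < 0.894 * a) {z : E3} (hz : z ∈ starSet a h (s 0) (-s (-1))) :
    z ∈ barlowStacking a h s ∧ ‖z‖ ≤ 6 * a / 5 := by
  have ha2 : 0 < a ^ 2 := by positivity
  have hh2 : h ^ 2 ≤ 0.8 * a ^ 2 := by nlinarith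
  -- norm bound from lattice coordinates
  have nb : ∀ p q zz : ℝ, p ^ 2 + p * q + q ^ 2 ≤ 1 / 3 ∨ (p ^ 2 + p * q + q ^ 2 ≤ 1 ∧ zz = 0) →
      zz ^ 2 ≤ 0.8 * a ^ 2 → ‖lc a p q zz‖ ≤ 6 * a / 5 := by
    intro p q zz hor hzz
    have hsq : ‖lc a p q zz‖ ^ 2 ≤ (6 * a / 5) ^ 2 := by
      rw [norm_lc_sq]
      rcases hor with h1 | ⟨h1, rfl⟩
      · nlinarith
      · nlinarith
    exact (pow_le_pow_iff_left₀ (norm_nonneg _) (by positivity) two_ne_zero).1 hsq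
  have hσ0 : (s 0 : ℝ) ^ 2 = 1 := by
    rcases hs 0 with h1 | h1 <;> rw [h1] <;> norm_num
  have hσ1 : (s (-1) : ℝ) ^ 2 = 1 := by
    rcases hs (-1) with h1 | h1 <;> rw [h1] <;> norm_num
  rw [mem_starSet_iff] at hz
  rcases hz with rfl | hz | hz | hz
  · refine ⟨⟨0, 0, 0, ?_⟩, by simp; positivity⟩
    rw [barlowPos_layer_zero]; simp
  · rw [mem_hexagon_iff] at hz
    have mem : ∀ i j : ℤ, lc a i j 0 ∈ barlowStacking a h s := fun i j =>
      ⟨0, i, j, (barlowPos_layer_zero a h s i j).symm⟩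
    rcases hz with rfl | rfl | rfl | rfl | rfl | rfl
    · exact ⟨by exact_mod_cast mem 1 0, nb _ _ _ (Or.inr ⟨by norm_num, rfl⟩) (by nlinarith)⟩
    · exact ⟨by exact_mod_cast mem (-1) 0, nb _ _ _ (Or.inr ⟨by norm_num, rfl⟩) (by nlinarith)⟩
    · exact ⟨by exact_mod_cast mem 0 1, nb _ _ _ (Or.inr ⟨by norm_num, rfl⟩) (by nlinarith)⟩
    · exact ⟨by exact_mod_cast mem 0 (-1), nb _ _ _ (Or.inr ⟨by norm_num, rfl⟩) (by nlinarith)⟩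
    · exact ⟨by exact_mod_cast mem 1 (-1), nb _ _ _ (Or.inr ⟨by norm_num, rfl⟩) (by nlinarith)⟩
    · exact ⟨by exact_mod_cast mem (-1) 1, nb _ _ _ (Or.inr ⟨by norm_num, rfl⟩) (by nlinarith)⟩
  · rw [mem_holes_iff] at hz
    have mem : ∀ i j : ℤ, lc a (i + s 0 / 3) (j + s 0 / 3) h ∈ barlowStacking a h s := fun i j =>
      ⟨1, i, j, (barlowPos_layer_one a h s i j).symm⟩
    rcases hz with rfl | rfl | rfl
    · refine ⟨?_, nb _ _ _ (Or.inl (by nlinarith)) hh2⟩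
      have := mem 0 0
      push_cast at this; simpa using this
    · refine ⟨?_, nb _ _ _ (Or.inl (by nlinarith)) hh2⟩
      have := mem (-(s 0)) 0
      push_cast at this
      convert this using 2 <;> ring
    · refine ⟨?_, nb _ _ _ (Or.inl (by nlinarith)) hh2⟩
      have := mem 0 (-(s 0))
      push_cast at this
      convert this using 2 <;> ring
  · rw [mem_holes_iff] at hz
    have hh2' : (-h) ^ 2 ≤ 0.8 * a ^ 2 := by simpa using hh2
    have mem : ∀ i j : ℤ, lc a (i - s (-1) / 3) (j - s (-1) / 3) (-h) ∈ barlowStacking a h s :=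
      fun i j => ⟨-1, i, j, (barlowPos_layer_neg_one a h s i j).symm⟩
    push_cast at hz
    rcases hz with rfl | rfl | rfl
    · refine ⟨?_, nb _ _ _ (Or.inl (by nlinarith)) hh2'⟩
      have := mem 0 0
      push_cast at this
      convert this using 2 <;> ring
    · refine ⟨?_, nb _ _ _ (Or.inl (by nlinarith)) hh2'⟩
      have := mem (s (-1)) 0
      push_cast at this
      convert this using 2 <;> ring
    · refine ⟨?_, nb _ _ _ (Or.inl (by nlinarith)) hh2'⟩
      have := mem 0 (s (-1))
      push_cast at this
      convert this using 2 <;> ring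

/-- **The `6a/5`-star of a relaxed Barlow stacking.** [folklore] -/
theorem barlowStacking_inter_closedBall (hs : IsHaggSeq s) (ha : 0 < a) (hw1 : 0.775 * a < h)
    (hw2 : h < 0.894 * a) :
    barlowStacking a h s ∩ closedBall (0 : E3) (6 * a / 5) = starSet a h (s 0) (-s (-1)) := by
  have hh : 0 < h := by linarith
  ext z
  simp only [Set.mem_inter_iff, mem_closedBall_zero_iff]
  constructor
  · rintro ⟨hz, hzn⟩
    exact mem_starSet_of_mem hs ha hw1 hz hzn
  · intro hz
    exact mem_and_norm_le_of_mem_starSet hs ha hh hw2 hz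

end Star

/-! ## Integer forms, hole classes, circumcentres -/

section Forms

/-- `i² + ij + j² = 1` has exactly the six unit solutions. [folklore] -/
theorem form_eq_one_iff (i j : ℤ) :
    i ^ 2 + i * j + j ^ 2 = 1 ↔
      (i = 1 ∧ j = 0) ∨ (i = -1 ∧ j = 0) ∨ (i = 0 ∧ j = 1) ∨ (i = 0 ∧ j = -1) ∨
        (i = 1 ∧ j = -1) ∨ (i = -1 ∧ j = 1) := by
  constructor
  · intro h
    exact (inLayer_eq_twelve_iff i j).1 (by linear_combination 12 * h)
  · rintro (⟨rfl, rfl⟩ | ⟨rfl, rfl⟩ | ⟨rfl, rfl⟩ | ⟨rfl, rfl⟩ | ⟨rfl, rfl⟩ | ⟨rfl, rfl⟩) <;> norm_num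

/-- `m² + mn + n² = 3` has exactly six solutions (the hole numerators). [folklore] -/
theorem form_eq_three_iff (m n : ℤ) :
    m ^ 2 + m * n + n ^ 2 = 3 ↔
      (m = 1 ∧ n = 1) ∨ (m = -2 ∧ n = 1) ∨ (m = 1 ∧ n = -2) ∨ (m = -1 ∧ n = -1) ∨
        (m = 2 ∧ n = -1) ∨ (m = -1 ∧ n = 2) := by
  constructor
  · intro h
    have hn : n ^ 2 ≤ 4 := by nlinarith [sq_nonneg (2 * m + n)]
    have hm : m ^ 2 ≤ 4 := by nlinarith [sq_nonneg (2 * n + m)]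
    obtain ⟨hn1, hn2⟩ := abs_le_two_of_sq_le_four hn
    obtain ⟨hm1, hm2⟩ := abs_le_two_of_sq_le_four hm
    interval_cases m <;> interval_cases n <;> omega
  · rintro (⟨rfl, rfl⟩ | ⟨rfl, rfl⟩ | ⟨rfl, rfl⟩ | ⟨rfl, rfl⟩ | ⟨rfl, rfl⟩ | ⟨rfl, rfl⟩) <;> norm_num

/-- `m² + mn + n² = 9` forces `3 ∣ m`. [folklore] -/
theorem three_dvd_of_form_eq_nine {m n : ℤ} (h : m ^ 2 + m * n + n ^ 2 = 9) : 3 ∣ m := by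
  have hn : n ^ 2 ≤ 12 := by nlinarith [sq_nonneg (2 * m + n)]
  have hm : m ^ 2 ≤ 12 := by nlinarith [sq_nonneg (2 * n + m)]
  have hn3 : -3 ≤ n ∧ n ≤ 3 := by constructor <;> nlinarith
  have hm3 : -3 ≤ m ∧ m ≤ 3 := by constructor <;> nlinarith
  obtain ⟨hn1, hn2⟩ := hn3
  obtain ⟨hm1, hm2⟩ := hm3
  interval_cases m <;> interval_cases n <;> omega

/-- The form is non-negative. [folklore] -/
theorem form_nonneg (x y : ℝ) : 0 ≤ x ^ 2 + x * y + y ^ 2 := by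
  nlinarith [sq_nonneg (x + y / 2), sq_nonneg y]

/-- The class of a hole numerator: `+1` for `m ≡ 1 (mod 3)` (the holes `w + Λ₀`), `−1` otherwise
(the holes `−w + Λ₀`). [folklore] -/
def hclass (m : ℤ) : ℤ := if m % 3 = 1 then 1 else -1

theorem hclass_eq_or (m : ℤ) : hclass m = 1 ∨ hclass m = -1 := by
  unfold hclass; split_ifs <;> simp

theorem hclass_eq_of_dvd_sub {m m' : ℤ} (h : 3 ∣ m - m') : hclass m = hclass m' := by
  have : m % 3 = m' % 3 := by omega
  unfold hclass
  rw [this]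

theorem hclass_neg {m n : ℤ} (h : m ^ 2 + m * n + n ^ 2 = 3) : hclass (-m) = -hclass m := by
  rcases (form_eq_three_iff m n).1 h with
    ⟨rfl, rfl⟩ | ⟨rfl, rfl⟩ | ⟨rfl, rfl⟩ | ⟨rfl, rfl⟩ | ⟨rfl, rfl⟩ | ⟨rfl, rfl⟩ <;> decide

variable {a : ℝ}

/-- Hexagon points are the integer unit vectors of the layer lattice. [folklore] -/
theorem mem_hexagon_iff_num {z : E3} :
    z ∈ hexagon a ↔ ∃ i j : ℤ, i ^ 2 + i * j + j ^ 2 = 1 ∧ z = lc a i j 0 := by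
  rw [mem_hexagon_iff]
  constructor
  · rintro (rfl | rfl | rfl | rfl | rfl | rfl)
    · exact ⟨1, 0, by norm_num, by push_cast; rfl⟩
    · exact ⟨-1, 0, by norm_num, by push_cast; rfl⟩
    · exact ⟨0, 1, by norm_num, by push_cast; rfl⟩
    · exact ⟨0, -1, by norm_num, by push_cast; rfl⟩
    · exact ⟨1, -1, by norm_num, by push_cast; rfl⟩
    · exact ⟨-1, 1, by norm_num, by push_cast; rfl⟩
  · rintro ⟨i, j, hij, rfl⟩
    rcases (form_eq_one_iff i j).1 hij with
      ⟨rfl, rfl⟩ | ⟨rfl, rfl⟩ | ⟨rfl, rfl⟩ | ⟨rfl, rfl⟩ | ⟨rfl, rfl⟩ | ⟨rfl, rfl⟩ <;>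
      push_cast <;> simp

/-- Hole points of class `κ` are `lc a (m/3) (n/3) zz` with `m² + mn + n² = 3`, `hclass m = κ`.
[folklore] -/
theorem mem_holes_iff_num (ha : a ≠ 0) {κ : ℤ} (hκ : κ = 1 ∨ κ = -1) {z : E3} {zz : ℝ} :
    z ∈ holes a κ zz ↔
      ∃ m n : ℤ, m ^ 2 + m * n + n ^ 2 = 3 ∧ hclass m = κ ∧ z = lc a (m / 3) (n / 3) zz := by
  rw [mem_holes_iff]
  constructor
  · rcases hκ with rfl | rfl
    · rintro (rfl | rfl | rfl)
      · exact ⟨1, 1, by norm_num, by decide, by push_cast; rfl⟩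
      · exact ⟨-2, 1, by norm_num, by decide, by rw [lc_eq_lc_iff ha]; push_cast; norm_num⟩
      · exact ⟨1, -2, by norm_num, by decide, by rw [lc_eq_lc_iff ha]; push_cast; norm_num⟩
    · rintro (rfl | rfl | rfl)
      · exact ⟨-1, -1, by norm_num, by decide, by push_cast; rfl⟩
      · exact ⟨2, -1, by norm_num, by decide, by rw [lc_eq_lc_iff ha]; push_cast; norm_num⟩
      · exact ⟨-1, 2, by norm_num, by decide, by rw [lc_eq_lc_iff ha]; push_cast; norm_num⟩
  · rintro ⟨m, n, hmn, hcl, rfl⟩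
    rcases (form_eq_three_iff m n).1 hmn with
      ⟨rfl, rfl⟩ | ⟨rfl, rfl⟩ | ⟨rfl, rfl⟩ | ⟨rfl, rfl⟩ | ⟨rfl, rfl⟩ | ⟨rfl, rfl⟩ <;>
      rcases hκ with rfl | rfl <;> simp [hclass] at hcl <;>
      simp only [lc_eq_lc_iff ha] <;> push_cast <;> norm_num

/-- Every point of `ℝ³` has lattice coordinates. [folklore] -/
theorem exists_eq_lc (ha : a ≠ 0) (t : E3) : ∃ x y z : ℝ, t = lc a x y z := by
  have hs : (√3 : ℝ) ≠ 0 := by positivity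
  refine ⟨t 0 / a - t 1 / (a * √3), 2 * t 1 / (a * √3), t 2, ?_⟩
  ext l
  fin_cases l <;> (simp [lc]; try field_simp; try ring)

/-- **Circumcentre lemma**: a point at the adjacent-layer distance `b = √(a²/3 + h²)` from the three
vertices `0, y, y'` of a unit triangle of the layer sits over its centroid at height `±h`. [folklore] -/
theorem circumcentre {a h p q p' q' x y z : ℝ} (ha : a ≠ 0)
    (hE1 : p ^ 2 + p * q + q ^ 2 = 1) (hE2 : p' ^ 2 + p' * q' + q' ^ 2 = 1)
    (hE3 : (p - p') ^ 2 + (p - p') * (q - q') + (q - q') ^ 2 = 1)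
    (h0 : ‖lc a x y z‖ ^ 2 = a ^ 2 / 3 + h ^ 2)
    (h1 : dist (lc a x y z) (lc a p q 0) ^ 2 = a ^ 2 / 3 + h ^ 2)
    (h2 : dist (lc a x y z) (lc a p' q' 0) ^ 2 = a ^ 2 / 3 + h ^ 2) :
    x = (p + p') / 3 ∧ y = (q + q') / 3 ∧ z ^ 2 = h ^ 2 := by
  rw [norm_lc_sq] at h0
  rw [dist_lc_sq] at h1 h2
  have ha2 : a ^ 2 ≠ 0 := pow_ne_zero 2 ha
  have hA1 : a ^ 2 * (x * (2 * p + q) + y * (p + 2 * q) - 1) = 0 := by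
    linear_combination h0 - h1 + a ^ 2 * hE1
  have hA2 : a ^ 2 * (x * (2 * p' + q') + y * (p' + 2 * q') - 1) = 0 := by
    linear_combination h0 - h2 + a ^ 2 * hE2
  have L1 : x * (2 * p + q) + y * (p + 2 * q) = 1 := by
    have := (mul_eq_zero.1 hA1).resolve_left ha2; linarith
  have L2 : x * (2 * p' + q') + y * (p' + 2 * q') = 1 := by
    have := (mul_eq_zero.1 hA2).resolve_left ha2; linarith
  have hB : 2 * p * p' + p * q' + p' * q + 2 * q * q' = 1 := by
    linear_combination hE1 + hE2 - hE3
  have M1 : (p + p') / 3 * (2 * p + q) + (q + q') / 3 * (p + 2 * q) = 1 := by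
    linear_combination (2 / 3) * hE1 + (1 / 3) * hB
  have M2 : (p + p') / 3 * (2 * p' + q') + (q + q') / 3 * (p' + 2 * q') = 1 := by
    linear_combination (2 / 3) * hE2 + (1 / 3) * hB
  have hD : (p * q' - q * p') ^ 2 = 1 := by
    linear_combination
      (4 / 3 * (p' ^ 2 + p' * q' + q' ^ 2 - 1) + 2 / 3 -
          1 / 3 * ((p ^ 2 + p * q + q ^ 2 - 1) + (p' ^ 2 + p' * q' + q' ^ 2 - 1) -
            ((p - p') ^ 2 + (p - p') * (q - q') + (q - q') ^ 2 - 1))) * hE1 +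
        (2 / 3 - 1 / 3 * ((p ^ 2 + p * q + q ^ 2 - 1) + (p' ^ 2 + p' * q' + q' ^ 2 - 1) -
            ((p - p') ^ 2 + (p - p') * (q - q') + (q - q') ^ 2 - 1))) * hE2 +
        (2 / 3 + 1 / 3 * ((p ^ 2 + p * q + q ^ 2 - 1) + (p' ^ 2 + p' * q' + q' ^ 2 - 1) -
            ((p - p') ^ 2 + (p - p') * (q - q') + (q - q') ^ 2 - 1))) * hE3
  have hD0 : 3 * (p * q' - q * p') ≠ 0 := by
    intro h0
    have : p * q' - q * p' = 0 := by linarith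
    rw [this] at hD; norm_num at hD
  have hx : (x - (p + p') / 3) * (3 * (p * q' - q * p')) = 0 := by
    linear_combination (p' + 2 * q') * (L1 - M1) - (p + 2 * q) * (L2 - M2)
  have hy : (y - (q + q') / 3) * (3 * (p * q' - q * p')) = 0 := by
    linear_combination -(2 * p' + q') * (L1 - M1) + (2 * p + q) * (L2 - M2)
  have hx' : x = (p + p') / 3 := eq_of_sub_eq_zero ((mul_eq_zero.1 hx).resolve_right hD0)
  have hy' : y = (q + q') / 3 := eq_of_sub_eq_zero ((mul_eq_zero.1 hy).resolve_right hD0)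
  subst hx' hy'
  refine ⟨rfl, rfl, ?_⟩
  linear_combination h0 - (2 * a ^ 2 / 9) * hE1 - (2 * a ^ 2 / 9) * hE2 + (a ^ 2 / 9) * hE3

end Forms

/-! ## Images of the standard star under a linear isometry fixing the hexagon -/

section Image

variable {a h : ℝ}

/-- Metric data of the listed hole points: norm, and an adjacent pair of hexagon points at the
adjacent-layer distance. [folklore] -/
theorem holes_witness {κ : ℤ} (hκ : κ = 1 ∨ κ = -1) {zz : ℝ} {t : E3}
    (ht : t ∈ holes a κ zz) :
    ‖t‖ ^ 2 = a ^ 2 / 3 + zz ^ 2 ∧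
    ∃ p q p' q' : ℝ, lc a p q 0 ∈ hexagon a ∧ lc a p' q' 0 ∈ hexagon a ∧
      p ^ 2 + p * q + q ^ 2 = 1 ∧ p' ^ 2 + p' * q' + q' ^ 2 = 1 ∧
      (p - p') ^ 2 + (p - p') * (q - q') + (q - q') ^ 2 = 1 ∧
      dist t (lc a p q 0) ^ 2 = a ^ 2 / 3 + zz ^ 2 ∧ dist t (lc a p' q' 0) ^ 2 = a ^ 2 / 3 + zz ^ 2 := by
  have hex : ∀ p q : ℝ, (p = 1 ∧ q = 0) ∨ (p = -1 ∧ q = 0) ∨ (p = 0 ∧ q = 1) ∨ (p = 0 ∧ q = -1) ∨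
      (p = 1 ∧ q = -1) ∨ (p = -1 ∧ q = 1) → lc a p q 0 ∈ hexagon a := by
    rintro p q (⟨rfl, rfl⟩ | ⟨rfl, rfl⟩ | ⟨rfl, rfl⟩ | ⟨rfl, rfl⟩ | ⟨rfl, rfl⟩ | ⟨rfl, rfl⟩) <;>
      simp [hexagon]
  rw [mem_holes_iff] at ht
  rcases hκ with rfl | rfl <;> rcases ht with rfl | rfl | rfl <;> push_cast
  · refine ⟨by rw [norm_lc_sq]; ring, 1, 0, 0, 1, hex _ _ (by norm_num), hex _ _ (by norm_num),
      by norm_num, by norm_num, by norm_num, by rw [dist_lc_sq]; ring, by rw [dist_lc_sq]; ring⟩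
  · refine ⟨by rw [norm_lc_sq]; ring, -1, 0, -1, 1, hex _ _ (by norm_num), hex _ _ (by norm_num),
      by norm_num, by norm_num, by norm_num, by rw [dist_lc_sq]; ring, by rw [dist_lc_sq]; ring⟩
  · refine ⟨by rw [norm_lc_sq]; ring, 0, -1, 1, -1, hex _ _ (by norm_num), hex _ _ (by norm_num),
      by norm_num, by norm_num, by norm_num, by rw [dist_lc_sq]; ring, by rw [dist_lc_sq]; ring⟩
  · refine ⟨by rw [norm_lc_sq]; ring, -1, 0, 0, -1, hex _ _ (by norm_num), hex _ _ (by norm_num),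
      by norm_num, by norm_num, by norm_num, by rw [dist_lc_sq]; ring, by rw [dist_lc_sq]; ring⟩
  · refine ⟨by rw [norm_lc_sq]; ring, 1, 0, 1, -1, hex _ _ (by norm_num), hex _ _ (by norm_num),
      by norm_num, by norm_num, by norm_num, by rw [dist_lc_sq]; ring, by rw [dist_lc_sq]; ring⟩
  · refine ⟨by rw [norm_lc_sq]; ring, 0, 1, -1, 1, hex _ _ (by norm_num), hex _ _ (by norm_num),
      by norm_num, by norm_num, by norm_num, by rw [dist_lc_sq]; ring, by rw [dist_lc_sq]; ring⟩

/-- Hole points have lattice coordinates with the given height. [folklore] -/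
theorem exists_lc_of_mem_holes {κ : ℤ} {zz : ℝ} {t : E3} (ht : t ∈ holes a κ zz) :
    ∃ p q : ℝ, t = lc a p q zz := by
  rw [mem_holes_iff] at ht
  rcases ht with rfl | rfl | rfl
  · exact ⟨_, _, rfl⟩
  · exact ⟨_, _, rfl⟩
  · exact ⟨_, _, rfl⟩

/-- **Image of a hole point** under a linear isometry mapping the hexagon into itself: a hole point
(numerators `M, N` with `M² + MN + N² = 3`) at height `±h`. [folklore] -/
theorem image_hole_form (ha : 0 < a) (B : E3 →ₗᵢ[ℝ] E3)
    (hB : ∀ x ∈ hexagon a, B x ∈ hexagon a) {κ : ℤ} (hκ : κ = 1 ∨ κ = -1) {zz : ℝ}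
    (hzz : zz ^ 2 = h ^ 2) {t : E3} (ht : t ∈ holes a κ zz) :
    ∃ (M N : ℤ) (ε : ℝ), M ^ 2 + M * N + N ^ 2 = 3 ∧ (ε = 1 ∨ ε = -1) ∧
      B t = lc a (M / 3) (N / 3) (ε * h) := by
  obtain ⟨hn, p, q, p', q', hx, hx', hE1, hE2, hE3, hd1, hd2⟩ := holes_witness hκ ht
  obtain ⟨i, j, hij, hy⟩ := mem_hexagon_iff_num.1 (hB _ hx)
  obtain ⟨i', j', hij', hy'⟩ := mem_hexagon_iff_num.1 (hB _ hx')
  obtain ⟨x0, y0, z0, ht'⟩ := exists_eq_lc ha.ne' (B t)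
  have ha2 : a ^ 2 ≠ 0 := by positivity
  -- adjacency of the images
  have hadj : ((i : ℝ) - i') ^ 2 + ((i : ℝ) - i') * ((j : ℝ) - j') + ((j : ℝ) - j') ^ 2 = 1 := by
    have h1 : dist (B (lc a p q 0)) (B (lc a p' q' 0)) ^ 2 = a ^ 2 := by
      rw [B.dist_map, dist_lc_sq]; linear_combination a ^ 2 * hE3
    rw [hy, hy', dist_lc_sq] at h1
    have : a ^ 2 * (((i : ℝ) - i') ^ 2 + ((i : ℝ) - i') * ((j : ℝ) - j') + ((j : ℝ) - j') ^ 2 - 1)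
        = 0 := by
      linear_combination h1
    have := (mul_eq_zero.1 this).resolve_left ha2
    linarith
  have h0 : ‖lc a x0 y0 z0‖ ^ 2 = a ^ 2 / 3 + h ^ 2 := by rw [← ht', B.norm_map, hn, hzz]
  have h1 : dist (lc a x0 y0 z0) (lc a i j 0) ^ 2 = a ^ 2 / 3 + h ^ 2 := by
    rw [← ht', ← hy, B.dist_map, hd1, hzz]
  have h2 : dist (lc a x0 y0 z0) (lc a i' j' 0) ^ 2 = a ^ 2 / 3 + h ^ 2 := by
    rw [← ht', ← hy', B.dist_map, hd2, hzz]
  have hE1' : (i : ℝ) ^ 2 + (i : ℝ) * j + (j : ℝ) ^ 2 = 1 := by exact_mod_cast hij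
  have hE2' : (i' : ℝ) ^ 2 + (i' : ℝ) * j' + (j' : ℝ) ^ 2 = 1 := by exact_mod_cast hij'
  obtain ⟨hx0, hy0, hz0⟩ := circumcentre ha.ne' hE1' hE2' hadj h0 h1 h2
  have hadjZ : (i - i') ^ 2 + (i - i') * (j - j') + (j - j') ^ 2 = 1 := by exact_mod_cast hadj
  have hMN : (i + i') ^ 2 + (i + i') * (j + j') + (j + j') ^ 2 = 3 := by
    linear_combination 2 * hij + 2 * hij' - hadjZ
  rcases sq_eq_sq_iff_eq_or_eq_neg.1 hz0 with hz | hz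
  · refine ⟨i + i', j + j', 1, hMN, Or.inl rfl, ?_⟩
    rw [ht', lc_eq_lc_iff ha.ne', hx0, hy0, hz]
    push_cast
    exact ⟨by ring, by ring, by ring⟩
  · refine ⟨i + i', j + j', -1, hMN, Or.inr rfl, ?_⟩
    rw [ht', lc_eq_lc_iff ha.ne', hx0, hy0, hz]
    push_cast
    exact ⟨by ring, by ring, by ring⟩

/-- **Sorting lemma**: two hole-type points `lc a (M/3) (N/3) (±h)` at distance exactly `a` lie at the
same height and in the same class (`h > 0.775 a`). [folklore] -/
theorem same_height_class (ha : 0 < a) (hw1 : 0.775 * a < h) {M N M' N' : ℤ} {ε ε' : ℝ}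
    (hε : ε = 1 ∨ ε = -1) (hε' : ε' = 1 ∨ ε' = -1)
    (hd : dist (lc a (M / 3) (N / 3) (ε * h)) (lc a (M' / 3) (N' / 3) (ε' * h)) = a) :
    ε = ε' ∧ hclass M = hclass M' := by
  have hh : 0 < h := by linarith
  have hh2 : 0.6 * a ^ 2 < h ^ 2 := by nlinarith
  have hd2 : dist (lc a (M / 3) (N / 3) (ε * h)) (lc a (M' / 3) (N' / 3) (ε' * h)) ^ 2 = a ^ 2 := by
    rw [hd]
  rw [dist_lc_sq] at hd2
  have hF := form_nonneg ((M : ℝ) / 3 - M' / 3) ((N : ℝ) / 3 - N' / 3)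
  have hεε : ε = ε' := by
    rcases hε with rfl | rfl <;> rcases hε' with rfl | rfl
    · rfl
    · exfalso; nlinarith
    · exfalso; nlinarith
    · rfl
  subst hεε
  refine ⟨rfl, ?_⟩
  have ha2 : a ^ 2 ≠ 0 := by positivity
  have h9R : ((M : ℝ) - M') ^ 2 + ((M : ℝ) - M') * ((N : ℝ) - N') + ((N : ℝ) - N') ^ 2 = 9 := by
    have : a ^ 2 * ((((M : ℝ) - M') ^ 2 + ((M : ℝ) - M') * ((N : ℝ) - N') +
        ((N : ℝ) - N') ^ 2) - 9) = 0 := by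
      linear_combination 9 * hd2
    have := (mul_eq_zero.1 this).resolve_left ha2
    linarith
  have h9 : (M - M') ^ 2 + (M - M') * (N - N') + (N - N') ^ 2 = 9 := by exact_mod_cast h9R
  exact hclass_eq_of_dvd_sub (three_dvd_of_form_eq_nine h9)

/-- The listed hole points are pairwise at distance `a`. [folklore] -/
theorem holes_pairwise (ha : 0 < a) {κ : ℤ} (hκ : κ = 1 ∨ κ = -1) (zz : ℝ) :
    dist (lc a (κ / 3) (κ / 3) zz) (lc a (κ / 3 - κ) (κ / 3) zz) = a ∧
    dist (lc a (κ / 3) (κ / 3) zz) (lc a (κ / 3) (κ / 3 - κ) zz) = a ∧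
    dist (lc a (κ / 3 - κ) (κ / 3) zz) (lc a (κ / 3) (κ / 3 - κ) zz) = a := by
  have hκ2 : (κ : ℝ) ^ 2 = 1 := by rcases hκ with rfl | rfl <;> norm_num
  refine ⟨(sq_eq_sq₀ dist_nonneg ha.le).1 ?_, (sq_eq_sq₀ dist_nonneg ha.le).1 ?_,
    (sq_eq_sq₀ dist_nonneg ha.le).1 ?_⟩ <;>
  · rw [dist_lc_sq]; linear_combination a ^ 2 * hκ2

/-- Hole triples are finite sets. [folklore] -/
theorem holes_finite (a : ℝ) (κ : ℤ) (zz : ℝ) : (holes a κ zz).Finite := by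
  unfold holes; exact Set.toFinite _

/-- The hexagon is a finite set. [folklore] -/
theorem hexagon_finite (a : ℝ) : (hexagon a).Finite := by
  unfold hexagon; exact Set.toFinite _

/-- **Image of a hole triple**: a linear isometry mapping the hexagon into itself maps the hole triple
of class `κ` at height `±h` onto a full hole triple of some class at height `±h`. [folklore] -/
theorem image_holes (ha : 0 < a) (hw1 : 0.775 * a < h) (B : E3 →ₗᵢ[ℝ] E3)
    (hB : ∀ x ∈ hexagon a, B x ∈ hexagon a) {κ : ℤ} (hκ : κ = 1 ∨ κ = -1) {zz : ℝ}
    (hzz : zz = h ∨ zz = -h) :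
    ∃ (κ' : ℤ) (ε : ℝ), (κ' = 1 ∨ κ' = -1) ∧ (ε = 1 ∨ ε = -1) ∧
      B '' holes a κ zz = holes a κ' (ε * h) := by
  have hzz2 : zz ^ 2 = h ^ 2 := by rcases hzz with rfl | rfl <;> ring
  have ht1 : lc a (κ / 3) (κ / 3) zz ∈ holes a κ zz := by simp [holes]
  have ht2 : lc a (κ / 3 - κ) (κ / 3) zz ∈ holes a κ zz := by simp [holes]
  have ht3 : lc a (κ / 3) (κ / 3 - κ) zz ∈ holes a κ zz := by simp [holes]
  obtain ⟨M1, N1, ε1, hMN1, hε1, hB1⟩ := image_hole_form ha B hB hκ hzz2 ht1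
  obtain ⟨M2, N2, ε2, hMN2, hε2, hB2⟩ := image_hole_form ha B hB hκ hzz2 ht2
  obtain ⟨M3, N3, ε3, hMN3, hε3, hB3⟩ := image_hole_form ha B hB hκ hzz2 ht3
  obtain ⟨d12, d13, d23⟩ := holes_pairwise ha hκ zz
  have e12 := same_height_class ha hw1 hε1 hε2 (by rw [← hB1, ← hB2, B.dist_map]; exact d12)
  have e13 := same_height_class ha hw1 hε1 hε3 (by rw [← hB1, ← hB3, B.dist_map]; exact d13)
  refine ⟨hclass M1, ε1, hclass_eq_or M1, hε1, ?_⟩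
  have hsub : B '' holes a κ zz ⊆ holes a (hclass M1) (ε1 * h) := by
    rintro y ⟨t, ht, rfl⟩
    rw [mem_holes_iff] at ht
    rcases ht with rfl | rfl | rfl
    · rw [hB1]
      exact (mem_holes_iff_num ha.ne' (hclass_eq_or M1)).2 ⟨M1, N1, hMN1, rfl, rfl⟩
    · rw [hB2]
      exact (mem_holes_iff_num ha.ne' (hclass_eq_or M1)).2 ⟨M2, N2, hMN2, e12.2.symm, by rw [e12.1]⟩
    · rw [hB3]
      exact (mem_holes_iff_num ha.ne' (hclass_eq_or M1)).2 ⟨M3, N3, hMN3, e13.2.symm, by rw [e13.1]⟩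
  -- equality by counting: three distinct images inside a three-point set
  have hne12 : lc a (κ / 3) (κ / 3) zz ≠ lc a (κ / 3 - κ) (κ / 3) zz := by
    intro e; rw [e, dist_self] at d12; linarith
  have hne13 : lc a (κ / 3) (κ / 3) zz ≠ lc a (κ / 3) (κ / 3 - κ) zz := by
    intro e; rw [e, dist_self] at d13; linarith
  have hne23 : lc a (κ / 3 - κ) (κ / 3) zz ≠ lc a (κ / 3) (κ / 3 - κ) zz := by
    intro e; rw [e, dist_self] at d23; linarith
  have hcard : (holes a κ zz).ncard = 3 := by
    simp only [holes]
    rw [Set.ncard_insert_of_notMem, Set.ncard_pair hne23]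
    simp only [Set.mem_insert_iff, Set.mem_singleton_iff, not_or]
    exact ⟨hne12, hne13⟩
  have hcard' : (B '' holes a κ zz).ncard = 3 := by
    rw [Set.ncard_image_of_injective _ B.injective, hcard]
  have hle : (holes a (hclass M1) (ε1 * h)).ncard ≤ 3 := by
    simp only [holes]
    calc (insert (lc a ((hclass M1 : ℤ) / 3) ((hclass M1 : ℤ) / 3) (ε1 * h))
            (insert (lc a ((hclass M1 : ℤ) / 3 - hclass M1) ((hclass M1 : ℤ) / 3) (ε1 * h))
              {lc a ((hclass M1 : ℤ) / 3) ((hclass M1 : ℤ) / 3 - hclass M1) (ε1 * h)}) : Set E3).ncard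
          ≤ (insert (lc a ((hclass M1 : ℤ) / 3 - hclass M1) ((hclass M1 : ℤ) / 3) (ε1 * h))
              {lc a ((hclass M1 : ℤ) / 3) ((hclass M1 : ℤ) / 3 - hclass M1) (ε1 * h)} : Set E3).ncard
              + 1 := Set.ncard_insert_le _ _
      _ ≤ ({lc a ((hclass M1 : ℤ) / 3) ((hclass M1 : ℤ) / 3 - hclass M1) (ε1 * h)} : Set E3).ncard
              + 1 + 1 := by gcongr; exact Set.ncard_insert_le _ _
      _ = 3 := by rw [Set.ncard_singleton]
  exact Set.eq_of_subset_of_ncard_le hsub (by rw [hcard']; exact hle) (holes_finite _ _ _)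

/-- **Image of the standard star**: a linear isometry mapping the hexagon ONTO itself maps a
standard star to a standard star (classes may change, e.g. under a 60° rotation or the flip
`e₃ ↦ −e₃`). [folklore] -/
theorem image_starSet (ha : 0 < a) (hw1 : 0.775 * a < h) (B : E3 →ₗᵢ[ℝ] E3)
    (hB : B '' hexagon a = hexagon a) {τ τ' : ℤ} (hτ : τ = 1 ∨ τ = -1) (hτ' : τ' = 1 ∨ τ' = -1) :
    ∃ κ κ' : ℤ, (κ = 1 ∨ κ = -1) ∧ (κ' = 1 ∨ κ' = -1) ∧
      B '' starSet a h τ τ' = starSet a h κ κ' := by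
  have hh : 0 < h := by linarith
  have hh2 : 0.6 * a ^ 2 < h ^ 2 := by nlinarith
  have hB' : ∀ x ∈ hexagon a, B x ∈ hexagon a := fun x hx => hB ▸ Set.mem_image_of_mem B hx
  obtain ⟨κp, εp, hκp, hεp, hup⟩ := image_holes ha hw1 B hB' hτ (Or.inl rfl : h = h ∨ h = -h)
  obtain ⟨κm, εm, hκm, hεm, hdn⟩ := image_holes ha hw1 B hB' hτ' (Or.inr rfl : -h = h ∨ -h = -h)
  -- the two image triples sit at opposite heights
  have hopp : εm = -εp := by
    by_contra hne
    have heq : εm = εp := by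
      rcases hεp with rfl | rfl <;> rcases hεm with rfl | rfl <;>
        first | rfl | exact absurd (by norm_num) hne
    rw [heq] at hdn
    rcases eq_or_ne κm κp with hk | hk
    · rw [hk, ← hup] at hdn
      have himg := B.injective.image_injective hdn
      have hmem : lc a (τ' / 3) (τ' / 3) (-h) ∈ holes a τ h := by rw [← himg]; simp [holes]
      rw [mem_holes_iff] at hmem
      rcases hmem with e | e | e <;> rw [lc_eq_lc_iff ha.ne'] at e <;> linarith [e.2.2]
    · have hk' : κm = -κp := by
        rcases hκp with rfl | rfl <;> rcases hκm with rfl | rfl <;> simp_all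
      have hP : lc a (κp / 3) (κp / 3) (εp * h) ∈ B '' holes a τ h := by rw [hup]; simp [holes]
      have hQ : lc a (2 * κp / 3) (-κp / 3) (εp * h) ∈ B '' holes a τ' (-h) := by
        rw [hdn, hk', mem_holes_iff]
        right; left
        rw [lc_eq_lc_iff ha.ne']
        push_cast
        exact ⟨by ring, by ring, rfl⟩
      obtain ⟨tp, htp, hP'⟩ := hP
      obtain ⟨tq, htq, hQ'⟩ := hQ
      obtain ⟨pp, qp, rfl⟩ := exists_lc_of_mem_holes htp
      obtain ⟨pq, qq, rfl⟩ := exists_lc_of_mem_holes htq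
      have hfar : (2 * h) ^ 2 ≤ dist (lc a pp qp h) (lc a pq qq (-h)) ^ 2 := by
        rw [dist_lc_sq]
        nlinarith [form_nonneg (pp - pq) (qp - qq)]
      have hnear : dist (B (lc a pp qp h)) (B (lc a pq qq (-h))) ^ 2 = a ^ 2 / 3 := by
        rw [hP', hQ', dist_lc_sq]
        have hκ2 : (κp : ℝ) ^ 2 = 1 := by rcases hκp with rfl | rfl <;> norm_num
        linear_combination (a ^ 2 / 3) * hκ2
      rw [B.dist_map] at hnear
      nlinarith
  have himage : B '' starSet a h τ τ' =
      {0} ∪ hexagon a ∪ holes a κp (εp * h) ∪ holes a κm (εm * h) := by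
    simp only [starSet, Set.image_union, Set.image_singleton, map_zero, hB, hup, hdn]
  rcases hεp with rfl | rfl
  · refine ⟨κp, κm, hκp, hκm, ?_⟩
    rw [himage, hopp, starSet]
    simp only [one_mul, neg_one_mul]
  · refine ⟨κm, κp, hκm, hκp, ?_⟩
    rw [himage, hopp, starSet]
    simp only [neg_one_mul, neg_neg, one_mul]
    ext z
    simp only [Set.mem_union]
    tauto

end Image

/-! ## Propagation in the base layer -/

section Propagation

variable {a h : ℝ}

/-- The local hypothesis of the stub in star form: every point of `Y` sees, within `6a/5`, a
linearly rotated standard star. [folklore] -/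
def StarHyp (a h : ℝ) (Y : Set E3) : Prop :=
  ∀ y ∈ Y, ∃ τ τ' : ℤ, (τ = 1 ∨ τ = -1) ∧ (τ' = 1 ∨ τ' = -1) ∧ ∃ B : E3 →ₗᵢ[ℝ] E3,
    ((fun z => z - y) '' Y) ∩ closedBall 0 (6 * a / 5) = B '' starSet a h τ τ'

/-- The stub's hypothesis gives `StarHyp`. [folklore] -/
theorem starHyp_of_local (ha : 0 < a) (hw1 : 0.775 * a < h) (hw2 : h < 0.894 * a) {Y : Set E3}
    (hloc : ∀ y ∈ Y, ∃ s : ℤ → ℤ, IsHaggSeq s ∧ ∃ B : E3 →ₗᵢ[ℝ] E3,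
      ((fun z => z - y) '' Y) ∩ closedBall 0 (6 * a / 5) =
        B '' (barlowStacking a h s ∩ closedBall 0 (6 * a / 5))) :
    StarHyp a h Y := by
  intro y hy
  obtain ⟨s, hs, B, hB⟩ := hloc y hy
  rw [barlowStacking_inter_closedBall hs ha hw1 hw2] at hB
  refine ⟨s 0, -s (-1), hs 0, ?_, B, hB⟩
  rcases hs (-1) with h1 | h1 <;> simp [h1]

/-- `StarHyp` is translation invariant. [folklore] -/
theorem starHyp_translate {Y : Set E3} (hY : StarHyp a h Y) (o : E3) :
    StarHyp a h ((fun z => z - o) '' Y) := by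
  rintro _ ⟨y, hy, rfl⟩
  obtain ⟨τ, τ', hτ, hτ', B, hB⟩ := hY y hy
  refine ⟨τ, τ', hτ, hτ', B, ?_⟩
  rw [← hB]
  congr 1
  ext z
  simp only [Set.mem_image]
  constructor
  · rintro ⟨_, ⟨w, hw, rfl⟩, rfl⟩
    exact ⟨w, hw, by abel⟩
  · rintro ⟨w, hw, rfl⟩
    exact ⟨w - o, ⟨w, hw, rfl⟩, by abel⟩

/-- `StarHyp` is invariant under linear isometric equivalences. [folklore] -/
theorem starHyp_image_equiv {Y : Set E3} (hY : StarHyp a h Y) (C : E3 ≃ₗᵢ[ℝ] E3) :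
    StarHyp a h (C '' Y) := by
  rintro _ ⟨y, hy, rfl⟩
  obtain ⟨τ, τ', hτ, hτ', B, hB⟩ := hY y hy
  refine ⟨τ, τ', hτ, hτ', C.toLinearIsometry.comp B, ?_⟩
  have h1 : (fun z => z - C y) '' (C '' Y) = C '' ((fun z => z - y) '' Y) := by
    ext z
    simp only [Set.mem_image]
    constructor
    · rintro ⟨_, ⟨w, hw, rfl⟩, rfl⟩
      exact ⟨w - y, ⟨w, hw, rfl⟩, by simp⟩
    · rintro ⟨_, ⟨w, hw, rfl⟩, rfl⟩
      exact ⟨C w, ⟨w, hw, rfl⟩, by simp⟩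
  have h2 : C '' ((fun z => z - y) '' Y) ∩ closedBall 0 (6 * a / 5) =
      C '' (((fun z => z - y) '' Y) ∩ closedBall 0 (6 * a / 5)) := by
    rw [Set.image_inter C.injective]
    congr 1
    ext z
    simp only [mem_closedBall_zero_iff, Set.mem_image]
    constructor
    · intro hz
      exact ⟨C.symm z, by simpa using hz, by simp⟩
    · rintro ⟨w, hw, rfl⟩
      simpa using hw
  rw [h1, h2, hB, Set.image_image]
  rfl

/-- Norms of star points: `0`, `a²` or `a²/3 + h²` (squared). [folklore] -/
theorem norm_sq_of_mem_starSet {τ τ' : ℤ} (hτ : τ = 1 ∨ τ = -1) (hτ' : τ' = 1 ∨ τ' = -1)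
    {t : E3} (ht : t ∈ starSet a h τ τ') :
    t = 0 ∨ (‖t‖ ^ 2 = a ^ 2 ∧ t ∈ hexagon a) ∨ ‖t‖ ^ 2 = a ^ 2 / 3 + h ^ 2 := by
  rw [mem_starSet_iff] at ht
  rcases ht with rfl | ht | ht | ht
  · exact Or.inl rfl
  · right; left
    refine ⟨?_, ht⟩
    obtain ⟨i, j, hij, rfl⟩ := mem_hexagon_iff_num.1 ht
    rw [norm_lc_sq]
    have : (i : ℝ) ^ 2 + (i : ℝ) * j + (j : ℝ) ^ 2 = 1 := by exact_mod_cast hij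
    rw [this]; ring
  · right; right
    have hτ2 : (τ : ℝ) ^ 2 = 1 := by rcases hτ with rfl | rfl <;> norm_num
    rw [mem_holes_iff] at ht
    rcases ht with rfl | rfl | rfl <;> rw [norm_lc_sq] <;> linear_combination (a ^ 2 / 3) * hτ2
  · right; right
    have hτ2 : (τ' : ℝ) ^ 2 = 1 := by rcases hτ' with rfl | rfl <;> norm_num
    rw [mem_holes_iff] at ht
    rcases ht with rfl | rfl | rfl <;> rw [norm_lc_sq] <;> linear_combination (a ^ 2 / 3) * hτ2

/-- Hexagon points have norm `a`. [folklore] -/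
theorem norm_of_mem_hexagon (ha : 0 ≤ a) {x : E3} (hx : x ∈ hexagon a) : ‖x‖ = a := by
  obtain ⟨i, j, hij, rfl⟩ := mem_hexagon_iff_num.1 hx
  have : ‖lc a i j 0‖ ^ 2 = a ^ 2 := by
    rw [norm_lc_sq]
    have : (i : ℝ) ^ 2 + (i : ℝ) * j + (j : ℝ) ^ 2 = 1 := by exact_mod_cast hij
    rw [this]; ring
  exact (sq_eq_sq₀ (norm_nonneg _) ha).1 this

/-- The hexagon is centrally symmetric. [folklore] -/
theorem neg_mem_hexagon {x : E3} (hx : x ∈ hexagon a) : -x ∈ hexagon a := by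
  obtain ⟨i, j, hij, rfl⟩ := mem_hexagon_iff_num.1 hx
  refine mem_hexagon_iff_num.2 ⟨-i, -j, by linear_combination hij, ?_⟩
  rw [neg_lc]; push_cast; simp

/-- OFF THE IDEAL RATIO, the star points of norm `a` are exactly the hexagon. [folklore] -/
theorem mem_hexagon_of_norm_eq (ha : 0 < a) (hne : h ^ 2 ≠ 2 * a ^ 2 / 3) {τ τ' : ℤ}
    (hτ : τ = 1 ∨ τ = -1) (hτ' : τ' = 1 ∨ τ' = -1) {t : E3} (ht : t ∈ starSet a h τ τ')
    (hn : ‖t‖ = a) : t ∈ hexagon a := by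
  rcases norm_sq_of_mem_starSet hτ hτ' ht with rfl | ⟨-, h⟩ | h2
  · simp at hn; linarith
  · exact h
  · exfalso; apply hne; rw [hn] at h2; linarith

section StarEq

variable {Y : Set E3} {y : E3} {τ τ' : ℤ} {B : E3 →ₗᵢ[ℝ] E3}

/-- From a star equation: the translated star points are points of `Y`. [folklore] -/
theorem add_mem_of_starEq
    (hstar : ((fun z => z - y) '' Y) ∩ closedBall 0 (6 * a / 5) = B '' starSet a h τ τ')
    {t : E3} (ht : t ∈ starSet a h τ τ') : y + B t ∈ Y := by
  have : B t ∈ ((fun z => z - y) '' Y) ∩ closedBall 0 (6 * a / 5) := by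
    rw [hstar]; exact Set.mem_image_of_mem B ht
  obtain ⟨⟨z, hz, hzt⟩, -⟩ := this
  dsimp only at hzt
  have : z = y + B t := by rw [← hzt]; abel
  exact this ▸ hz

/-- From a star equation: points of `Y` within `6a/5` of `y` are translated star points. [folklore] -/
theorem exists_of_starEq
    (hstar : ((fun z => z - y) '' Y) ∩ closedBall 0 (6 * a / 5) = B '' starSet a h τ τ')
    {z : E3} (hz : z ∈ Y) (hd : dist z y ≤ 6 * a / 5) : ∃ t ∈ starSet a h τ τ', z - y = B t := by
  have : z - y ∈ ((fun z => z - y) '' Y) ∩ closedBall 0 (6 * a / 5) :=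
    ⟨Set.mem_image_of_mem _ hz, by rwa [mem_closedBall_zero_iff, ← dist_eq_norm]⟩
  rw [hstar] at this
  obtain ⟨t, ht, hte⟩ := this
  exact ⟨t, ht, hte.symm⟩

/-- Same for the standard (unrotated) star equation. [folklore] -/
theorem exists_of_starEq_std
    (hstar : ((fun z => z - y) '' Y) ∩ closedBall 0 (6 * a / 5) = starSet a h τ τ')
    {z : E3} (hz : z ∈ Y) (hd : dist z y ≤ 6 * a / 5) : z - y ∈ starSet a h τ τ' := by
  have : z - y ∈ ((fun z => z - y) '' Y) ∩ closedBall 0 (6 * a / 5) :=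
    ⟨Set.mem_image_of_mem _ hz, by rwa [mem_closedBall_zero_iff, ← dist_eq_norm]⟩
  rwa [hstar] at this

theorem add_mem_of_starEq_std
    (hstar : ((fun z => z - y) '' Y) ∩ closedBall 0 (6 * a / 5) = starSet a h τ τ')
    {t : E3} (ht : t ∈ starSet a h τ τ') : y + t ∈ Y := by
  have : t ∈ ((fun z => z - y) '' Y) ∩ closedBall 0 (6 * a / 5) := by rw [hstar]; exact ht
  obtain ⟨⟨z, hz, hzt⟩, -⟩ := this
  dsimp only at hzt
  have : z = y + t := by rw [← hzt]; abel
  exact this ▸ hz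

end StarEq

/-- A hexagon neighbour present in `Y` is the image of a hexagon point of the model star. [folklore] -/
theorem mem_image_hexagon (ha : 0 < a) (hne : h ^ 2 ≠ 2 * a ^ 2 / 3) {Y : Set E3} {y : E3}
    {τ τ' : ℤ} (hτ : τ = 1 ∨ τ = -1) (hτ' : τ' = 1 ∨ τ' = -1) {B : E3 →ₗᵢ[ℝ] E3}
    (hstar : ((fun z => z - y) '' Y) ∩ closedBall 0 (6 * a / 5) = B '' starSet a h τ τ')
    {x : E3} (hx : x ∈ hexagon a) (hyx : y + x ∈ Y) : x ∈ B '' hexagon a := by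
  have hxn : ‖x‖ = a := norm_of_mem_hexagon ha.le hx
  have hd : dist (y + x) y ≤ 6 * a / 5 := by
    rw [dist_eq_norm, add_sub_cancel_left, hxn]; linarith
  obtain ⟨t, ht, hte⟩ := exists_of_starEq hstar hyx hd
  rw [add_sub_cancel_left] at hte
  refine ⟨t, mem_hexagon_of_norm_eq ha hne hτ hτ' ht ?_, hte.symm⟩
  rw [← B.norm_map, ← hte, hxn]

/-- If the hexagon is inside the image of the hexagon under an injective map, they are equal. [folklore] -/
theorem image_hexagon_eq (B : E3 →ₗᵢ[ℝ] E3) (hsub : hexagon a ⊆ B '' hexagon a) :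
    B '' hexagon a = hexagon a :=
  (Set.eq_of_subset_of_ncard_le hsub (by rw [Set.ncard_image_of_injective _ B.injective])
    ((hexagon_finite a).image B)).symm

/-- **Local standardness**: a point of `Y` all of whose six hexagon translates lie in `Y` has a
standard (unrotated) star. [folklore] -/
theorem star_standard (ha : 0 < a) (hw1 : 0.775 * a < h) (hne : h ^ 2 ≠ 2 * a ^ 2 / 3)
    {Y : Set E3} (hY : StarHyp a h Y) {y : E3} (hy : y ∈ Y) (hhex : ∀ x ∈ hexagon a, y + x ∈ Y) :
    ∃ κ κ' : ℤ, (κ = 1 ∨ κ = -1) ∧ (κ' = 1 ∨ κ' = -1) ∧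
      ((fun z => z - y) '' Y) ∩ closedBall 0 (6 * a / 5) = starSet a h κ κ' := by
  obtain ⟨τ, τ', hτ, hτ', B, hstar⟩ := hY y hy
  have hsub : hexagon a ⊆ B '' hexagon a := fun x hx =>
    mem_image_hexagon ha hne hτ hτ' hstar hx (hhex x hx)
  have hB := image_hexagon_eq B hsub
  obtain ⟨κ, κ', hκ, hκ', himg⟩ := image_starSet ha hw1 B hB hτ hτ'
  exact ⟨κ, κ', hκ, hκ', by rw [hstar, himg]⟩

/-- **Three neighbours suffice**: if `y ∈ Y` has three hexagon translates in `Y` whose `±` closure is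
the whole hexagon, then all six hexagon translates lie in `Y` (central symmetry of the rotated
hexagon). [folklore] -/
theorem hexagon_subset_of_three (ha : 0 < a) (hne : h ^ 2 ≠ 2 * a ^ 2 / 3)
    {Y : Set E3} (hY : StarHyp a h Y) {y : E3} (hy : y ∈ Y) {x₁ x₂ x₃ : E3}
    (h₁ : x₁ ∈ hexagon a) (h₂ : x₂ ∈ hexagon a) (h₃ : x₃ ∈ hexagon a)
    (hcov : ∀ x ∈ hexagon a, x = x₁ ∨ x = x₂ ∨ x = x₃ ∨ x = -x₁ ∨ x = -x₂ ∨ x = -x₃)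
    (hy₁ : y + x₁ ∈ Y) (hy₂ : y + x₂ ∈ Y) (hy₃ : y + x₃ ∈ Y) : ∀ x ∈ hexagon a, y + x ∈ Y := by
  obtain ⟨τ, τ', hτ, hτ', B, hstar⟩ := hY y hy
  have key : ∀ x ∈ hexagon a, y + x ∈ Y → y + -x ∈ Y := by
    intro x hx hyx
    obtain ⟨t, ht, rfl⟩ := mem_image_hexagon ha hne hτ hτ' hstar hx hyx
    rw [← map_neg]
    exact add_mem_of_starEq hstar (mem_starSet_of_mem_hexagon (neg_mem_hexagon ht))
  intro x hx
  rcases hcov x hx with rfl | rfl | rfl | rfl | rfl | rfl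
  · exact hy₁
  · exact hy₂
  · exact hy₃
  · exact key _ h₁ hy₁
  · exact key _ h₂ hy₂
  · exact key _ h₃ hy₃

/-- The `±` closure of `{u, v, u − v}` is the hexagon. [folklore] -/
theorem hexagon_cover {x : E3} (hx : x ∈ hexagon a) :
    x = lc a 1 0 0 ∨ x = lc a 0 1 0 ∨ x = lc a 1 (-1) 0 ∨
      x = -lc a 1 0 0 ∨ x = -lc a 0 1 0 ∨ x = -lc a 1 (-1) 0 := by
  rw [mem_hexagon_iff] at hx
  simp only [neg_lc, neg_zero]
  rcases hx with rfl | rfl | rfl | rfl | rfl | rfl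
  · exact Or.inl rfl
  · exact Or.inr (Or.inr (Or.inr (Or.inl rfl)))
  · exact Or.inr (Or.inl rfl)
  · exact Or.inr (Or.inr (Or.inr (Or.inr (Or.inl rfl))))
  · exact Or.inr (Or.inr (Or.inl rfl))
  · refine Or.inr (Or.inr (Or.inr (Or.inr (Or.inr ?_))))
    norm_num

/-- **Base layer**: if the star at `0 ∈ Y` is standard, the whole triangular lattice `Λ₀` lies in
`Y`, each point with all six hexagon translates in `Y`. [folklore] -/
theorem base_layer (ha : 0 < a) (hne : h ^ 2 ≠ 2 * a ^ 2 / 3)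
    {Y : Set E3} (hY : StarHyp a h Y) {τ₀ τ₀' : ℤ}
    (h0 : ((fun z => z - (0 : E3)) '' Y) ∩ closedBall 0 (6 * a / 5) = starSet a h τ₀ τ₀') :
    ∀ i j : ℤ, lc a i j 0 ∈ Y ∧ ∀ x ∈ hexagon a, lc a i j 0 + x ∈ Y := by
  -- hexagon memberships of the step vectors
  have hu : lc a 1 0 0 ∈ hexagon a := by simp [hexagon]
  have hu' : lc a (-1) 0 0 ∈ hexagon a := by simp [hexagon]
  have hv : lc a 0 1 0 ∈ hexagon a := by simp [hexagon]
  have hv' : lc a 0 (-1) 0 ∈ hexagon a := by simp [hexagon]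
  have huv : lc a 1 (-1) 0 ∈ hexagon a := by simp [hexagon]
  have huv' : lc a (-1) 1 0 ∈ hexagon a := by simp [hexagon]
  have hneg1 : -lc a 1 0 0 = lc a (-1) 0 0 := by rw [neg_lc]; norm_num
  have hneg2 : -lc a 0 1 0 = lc a 0 (-1) 0 := by rw [neg_lc]; norm_num
  have hneg3 : -lc a 1 (-1) 0 = lc a (-1) 1 0 := by rw [neg_lc]; norm_num
  -- the generic step: from a good point `p` to `p + e`
  have step : ∀ p : E3, (p ∈ Y ∧ ∀ x ∈ hexagon a, p + x ∈ Y) →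
      ∀ e ∈ hexagon a, (p + e ∈ Y ∧ ∀ x ∈ hexagon a, p + e + x ∈ Y) := by
    rintro p ⟨hp, hpx⟩ e he
    refine ⟨hpx e he, ?_⟩
    have hq : p + e ∈ Y := hpx e he
    -- three known neighbours of q = p + e : q - e = p, and q + (x - e) for the two x adjacent to e
    have known : ∀ x : E3, (x = 0 ∨ x ∈ hexagon a) → p + e + (x - e) ∈ Y := by
      rintro x (rfl | hx)
      · simpa using hp
      · have : p + e + (x - e) = p + x := by abel
        rw [this]; exact hpx x hx
    rcases hexagon_cover he with rfl | rfl | rfl | rfl | rfl | rfl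
    · -- e = u : known -u, -v, -(u-v)
      refine hexagon_subset_of_three ha hne hY hq hu' hv' huv' ?_ ?_ ?_ ?_
      · intro x hx
        rcases hexagon_cover hx with rfl | rfl | rfl | rfl | rfl | rfl <;>
          simp only [neg_lc] <;> norm_num
      · have := known 0 (Or.inl rfl)
        rw [zero_sub, hneg1] at this; exact this
      · have := known _ (Or.inr huv)
        rwa [lc_sub_lc, show ((1:ℝ) - 1) = 0 by norm_num, show ((-1:ℝ) - 0) = -1 by norm_num,
          sub_zero] at this
      · have := known _ (Or.inr hv)
        rwa [lc_sub_lc, show ((0:ℝ) - 1) = -1 by norm_num, show ((1:ℝ) - 0) = 1 by norm_num,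
          sub_zero] at this
    · -- e = v : known -v, -u, u-v
      refine hexagon_subset_of_three ha hne hY hq hv' hu' huv ?_ ?_ ?_ ?_
      · intro x hx
        rcases hexagon_cover hx with rfl | rfl | rfl | rfl | rfl | rfl <;>
          simp only [neg_lc] <;> norm_num
      · have := known 0 (Or.inl rfl)
        rw [zero_sub, hneg2] at this; exact this
      · have := known _ (Or.inr huv')
        rwa [lc_sub_lc, show ((-1:ℝ) - 0) = -1 by norm_num, show ((1:ℝ) - 1) = 0 by norm_num,
          sub_zero] at this
      · have := known _ (Or.inr hu)
        rwa [lc_sub_lc, show ((1:ℝ) - 0) = 1 by norm_num, show ((0:ℝ) - 1) = -1 by norm_num,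
          sub_zero] at this
    · -- e = u - v : known -(u-v), -u? : q = p + (u - v); q + x = p + (u - v + x):
      -- x = -(u-v) -> p ; x = -u -> p - v ; x = v -> p + u
      refine hexagon_subset_of_three ha hne hY hq huv' hu' hv ?_ ?_ ?_ ?_
      · intro x hx
        rcases hexagon_cover hx with rfl | rfl | rfl | rfl | rfl | rfl <;>
          simp only [neg_lc] <;> norm_num
      · have := known 0 (Or.inl rfl)
        rw [zero_sub, hneg3] at this; exact this
      · have := known _ (Or.inr hv')
        rwa [lc_sub_lc, show ((0:ℝ) - 1) = -1 by norm_num, show ((-1:ℝ) - -1) = 0 by norm_num,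
          sub_zero] at this
      · have := known _ (Or.inr hu)
        rwa [lc_sub_lc, show ((1:ℝ) - 1) = 0 by norm_num, show ((0:ℝ) - -1) = 1 by norm_num,
          sub_zero] at this
    · -- e = -u : known u, v, u - v
      rw [hneg1] at hq known ⊢
      refine hexagon_subset_of_three ha hne hY hq hu hv huv ?_ ?_ ?_ ?_
      · intro x hx
        rcases hexagon_cover hx with rfl | rfl | rfl | rfl | rfl | rfl <;>
          simp only [neg_lc] <;> norm_num
      · have := known 0 (Or.inl rfl)
        rwa [zero_sub, neg_lc, show (-(-1):ℝ) = 1 by norm_num, neg_zero] at this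
      · have := known _ (Or.inr huv')
        rwa [lc_sub_lc, show ((-1:ℝ) - -1) = 0 by norm_num, show ((1:ℝ) - 0) = 1 by norm_num,
          sub_zero] at this
      · have := known _ (Or.inr hv')
        rwa [lc_sub_lc, show ((0:ℝ) - -1) = 1 by norm_num, show ((-1:ℝ) - 0) = -1 by norm_num,
          sub_zero] at this
    · -- e = -v : known v, u, -(u-v)
      rw [hneg2] at hq known ⊢
      refine hexagon_subset_of_three ha hne hY hq hv hu huv' ?_ ?_ ?_ ?_
      · intro x hx
        rcases hexagon_cover hx with rfl | rfl | rfl | rfl | rfl | rfl <;>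
          simp only [neg_lc] <;> norm_num
      · have := known 0 (Or.inl rfl)
        rwa [zero_sub, neg_lc, show (-(-1):ℝ) = 1 by norm_num, neg_zero] at this
      · have := known _ (Or.inr huv)
        rwa [lc_sub_lc, show ((1:ℝ) - 0) = 1 by norm_num, show ((-1:ℝ) - -1) = 0 by norm_num,
          sub_zero] at this
      · have := known _ (Or.inr hu')
        rwa [lc_sub_lc, show ((-1:ℝ) - 0) = -1 by norm_num, show ((0:ℝ) - -1) = 1 by norm_num,
          sub_zero] at this
    · -- e = -(u - v) = v - u : known u - v, v?, -u : q = p + (v - u); q + x = p + (v - u + x):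
      -- x = u - v -> p ; x = u -> p + v ; x = -v -> p - u
      rw [hneg3] at hq known ⊢
      refine hexagon_subset_of_three ha hne hY hq huv hu hv' ?_ ?_ ?_ ?_
      · intro x hx
        rcases hexagon_cover hx with rfl | rfl | rfl | rfl | rfl | rfl <;>
          simp only [neg_lc] <;> norm_num
      · have := known 0 (Or.inl rfl)
        rwa [zero_sub, neg_lc, show (-(-1):ℝ) = 1 by norm_num, show (-(1:ℝ)) = -1 by norm_num,
          neg_zero] at this
      · have := known _ (Or.inr hv)
        rwa [lc_sub_lc, show ((0:ℝ) - -1) = 1 by norm_num, show ((1:ℝ) - 1) = 0 by norm_num,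
          sub_zero] at this
      · have := known _ (Or.inr hu')
        rwa [lc_sub_lc, show ((-1:ℝ) - -1) = 0 by norm_num, show ((0:ℝ) - 1) = -1 by norm_num,
          sub_zero] at this
  -- the root
  have hroot : (0 : E3) ∈ Y ∧ ∀ x ∈ hexagon a, (0 : E3) + x ∈ Y := by
    have h0' : ((fun z => z - (0 : E3)) '' Y) = Y := by simp
    rw [h0'] at h0
    have hsub : starSet a h τ₀ τ₀' ⊆ Y := fun t ht => (h0.symm ▸ ht : t ∈ Y ∩ _).1
    exact ⟨hsub (zero_mem_starSet a h τ₀ τ₀'), fun x hx => by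
      rw [zero_add]; exact hsub (mem_starSet_of_mem_hexagon hx)⟩
  -- induction along `u`, then along `v`
  have hrow : ∀ i : ℤ, lc a i 0 0 ∈ Y ∧ ∀ x ∈ hexagon a, lc a i 0 0 + x ∈ Y := by
    intro i
    induction i using Int.induction_on with
    | zero => simpa using hroot
    | succ n ih =>
      have := step _ ih _ hu
      rwa [lc_add_lc, show ((n:ℤ):ℝ) + 1 = (((n:ℤ) + 1 : ℤ) : ℝ) by push_cast; ring, add_zero] at this
    | pred n ih =>
      have := step _ ih _ hu'
      rwa [lc_add_lc, show (((-(n:ℤ)):ℤ):ℝ) + -1 = ((-(n:ℤ) - 1 : ℤ) : ℝ) by push_cast; ring,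
        add_zero] at this
  intro i j
  induction j using Int.induction_on with
  | zero => simpa using hrow i
  | succ n ih =>
    have := step _ ih _ hv
    rw [lc_add_lc, show ((n:ℤ):ℝ) + 1 = (((n:ℤ) + 1 : ℤ) : ℝ) by push_cast; ring] at this
    simp only [add_zero] at this
    exact this
  | pred n ih =>
    have := step _ ih _ hv'
    rw [lc_add_lc, show (((-(n:ℤ)):ℤ):ℝ) + -1 = ((-(n:ℤ) - 1 : ℤ) : ℝ) by push_cast; ring] at this
    simp only [add_zero] at this
    exact this

end Propagation

/-! ## One layer: class consistency and the slab -/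

section OneLayer

variable {a h : ℝ}

/-- Reading the class of an upper hole point off a standard star. [folklore] -/
theorem hclass_of_mem_starSet_up (ha : a ≠ 0) (hh : 0 < h) {κ κ' : ℤ} (hκ : κ = 1 ∨ κ = -1)
    (hκ' : κ' = 1 ∨ κ' = -1) {M N : ℤ}
    (hmem : lc a ((M : ℝ) / 3) ((N : ℝ) / 3) h ∈ starSet a h κ κ') : hclass M = κ := by
  rw [mem_starSet_iff] at hmem
  rcases hmem with e | e | e | e
  · rw [← lc_zero a, lc_eq_lc_iff ha] at e; linarith [e.2.2]
  · obtain ⟨i, j, -, e⟩ := mem_hexagon_iff_num.1 e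
    rw [lc_eq_lc_iff ha] at e; linarith [e.2.2]
  · obtain ⟨M', N', -, hcl, e⟩ := (mem_holes_iff_num ha hκ).1 e
    rw [lc_eq_lc_iff ha] at e
    have : (M : ℝ) = M' := by linarith [e.1]
    have : M = M' := by exact_mod_cast this
    rw [this, hcl]
  · obtain ⟨M', N', -, -, e⟩ := (mem_holes_iff_num ha hκ').1 e
    rw [lc_eq_lc_iff ha] at e; linarith [e.2.2]

/-- Reading the class of a lower hole point off a standard star. [folklore] -/
theorem hclass_of_mem_starSet_dn (ha : a ≠ 0) (hh : 0 < h) {κ κ' : ℤ} (hκ : κ = 1 ∨ κ = -1)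
    (hκ' : κ' = 1 ∨ κ' = -1) {M N : ℤ}
    (hmem : lc a ((M : ℝ) / 3) ((N : ℝ) / 3) (-h) ∈ starSet a h κ κ') : hclass M = κ' := by
  rw [mem_starSet_iff] at hmem
  rcases hmem with e | e | e | e
  · rw [← lc_zero a, lc_eq_lc_iff ha] at e; linarith [e.2.2]
  · obtain ⟨i, j, -, e⟩ := mem_hexagon_iff_num.1 e
    rw [lc_eq_lc_iff ha] at e; linarith [e.2.2]
  · obtain ⟨M', N', -, -, e⟩ := (mem_holes_iff_num ha hκ).1 e
    rw [lc_eq_lc_iff ha] at e; linarith [e.2.2]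
  · obtain ⟨M', N', -, hcl, e⟩ := (mem_holes_iff_num ha hκ').1 e
    rw [lc_eq_lc_iff ha] at e
    have : (M : ℝ) = M' := by linarith [e.1]
    have : M = M' := by exact_mod_cast this
    rw [this, hcl]

/-- A hole-type offset has norm `≤ 6a/5` on the window. [folklore] -/
theorem norm_hole_le (ha : 0 < a) (hh : 0 < h) (hw2 : h < 0.894 * a) {x y zz : ℝ}
    (hE : x ^ 2 + x * y + y ^ 2 = 1 / 3) (hzz : zz = h ∨ zz = -h) : ‖lc a x y zz‖ ≤ 6 * a / 5 := by
  have hsq : ‖lc a x y zz‖ ^ 2 ≤ (6 * a / 5) ^ 2 := by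
    rw [norm_lc_sq, hE]
    have : zz ^ 2 = h ^ 2 := by rcases hzz with rfl | rfl <;> ring
    rw [this]; nlinarith
  exact (pow_le_pow_iff_left₀ (norm_nonneg _) (by positivity) two_ne_zero).1 hsq

/-- Hole numerators of class `κ` are `≡ κ (mod 3)`. [folklore] -/
theorem exists_numerators {M N κ : ℤ} (hκ : κ = 1 ∨ κ = -1) (hMN : M ^ 2 + M * N + N ^ 2 = 3)
    (hcl : hclass M = κ) : ∃ i j : ℤ, M = 3 * i + κ ∧ N = 3 * j + κ := by
  rcases (form_eq_three_iff M N).1 hMN with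
    ⟨rfl, rfl⟩ | ⟨rfl, rfl⟩ | ⟨rfl, rfl⟩ | ⟨rfl, rfl⟩ | ⟨rfl, rfl⟩ | ⟨rfl, rfl⟩ <;>
    rcases hκ with rfl | rfl <;> simp [hclass] at hcl
  · exact ⟨0, 0, by norm_num, by norm_num⟩
  · exact ⟨-1, 0, by norm_num, by norm_num⟩
  · exact ⟨0, -1, by norm_num, by norm_num⟩
  · exact ⟨0, 0, by norm_num, by norm_num⟩
  · exact ⟨1, 0, by norm_num, by norm_num⟩
  · exact ⟨0, 1, by norm_num, by norm_num⟩

/-- **Covering**: every point of the plane is within `√7/4 · a` (in the layer metric) of a lattice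
point. [folklore] -/
theorem exists_near_lattice (x y : ℝ) :
    ∃ i j : ℤ, (x - i) ^ 2 + (x - i) * (y - j) + (y - j) ^ 2 ≤ 7 / 16 := by
  refine ⟨round (x + (y - round y) / 2), round y, ?_⟩
  have h1 := abs_sub_round y
  have h2 := abs_sub_round (x + (y - round y) / 2)
  rw [abs_le] at h1 h2
  nlinarith [sq_nonneg (x - round (x + (y - round y) / 2) + (y - round y) / 2),
    sq_nonneg (y - round y)]

/-- **One layer**: if the whole lattice `Λ₀` lies in `Z`, every lattice point has a STANDARD star
with the SAME classes `τ` (above) and `τ'` (below). [folklore] -/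
theorem one_layer (ha : 0 < a) (hw1 : 0.775 * a < h) (hw2 : h < 0.894 * a)
    (hne : h ^ 2 ≠ 2 * a ^ 2 / 3) {Z : Set E3} (hZ : StarHyp a h Z)
    (hΛ : ∀ i j : ℤ, lc a i j 0 ∈ Z) :
    ∃ τ τ' : ℤ, (τ = 1 ∨ τ = -1) ∧ (τ' = 1 ∨ τ' = -1) ∧
      ∀ i j : ℤ, ((fun z => z - lc a i j 0) '' Z) ∩ closedBall 0 (6 * a / 5) = starSet a h τ τ' := by
  have hh : 0 < h := by linarith
  -- pointwise standard stars
  have hstd : ∀ i j : ℤ, ∃ κ κ' : ℤ, (κ = 1 ∨ κ = -1) ∧ (κ' = 1 ∨ κ' = -1) ∧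
      ((fun z => z - lc a i j 0) '' Z) ∩ closedBall 0 (6 * a / 5) = starSet a h κ κ' := by
    intro i j
    refine star_standard ha hw1 hne hZ (hΛ i j) ?_
    intro x hx
    obtain ⟨i₁, j₁, -, rfl⟩ := mem_hexagon_iff_num.1 hx
    rw [lc_add_lc, add_zero]
    exact_mod_cast hΛ (i + i₁) (j + j₁)
  choose κ κ' hκ hκ' hst using hstd
  -- a generic class-transfer step
  have transfer_up : ∀ (i j i' j' : ℤ) (x y : ℝ) (M N : ℤ),
      lc a x y h ∈ holes a (κ i' j') h →
      lc a (i' + x - i) (j' + y - j) h = lc a ((M : ℝ) / 3) ((N : ℝ) / 3) h →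
      (((M : ℝ) / 3) ^ 2 + ((M : ℝ) / 3) * ((N : ℝ) / 3) + ((N : ℝ) / 3) ^ 2 = 1 / 3) →
      hclass M = κ i j := by
    intro i j i' j' x y M N hmem heq hE
    have hr : lc a i' j' 0 + lc a x y h ∈ Z :=
      add_mem_of_starEq_std (hst i' j') (mem_starSet_up hmem)
    have hd : dist (lc a i' j' 0 + lc a x y h) (lc a i j 0) ≤ 6 * a / 5 := by
      rw [dist_eq_norm, lc_add_lc, lc_sub_lc, zero_add, sub_zero, heq]
      exact norm_hole_le ha hh hw2 hE (Or.inl rfl)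
    have hmem' := exists_of_starEq_std (hst i j) hr hd
    rw [lc_add_lc, lc_sub_lc, zero_add, sub_zero, heq] at hmem'
    exact hclass_of_mem_starSet_up ha.ne' hh (hκ i j) (hκ' i j) hmem'
  have transfer_dn : ∀ (i j i' j' : ℤ) (x y : ℝ) (M N : ℤ),
      lc a x y (-h) ∈ holes a (κ' i' j') (-h) →
      lc a (i' + x - i) (j' + y - j) (-h) = lc a ((M : ℝ) / 3) ((N : ℝ) / 3) (-h) →
      (((M : ℝ) / 3) ^ 2 + ((M : ℝ) / 3) * ((N : ℝ) / 3) + ((N : ℝ) / 3) ^ 2 = 1 / 3) →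
      hclass M = κ' i j := by
    intro i j i' j' x y M N hmem heq hE
    have hr : lc a i' j' 0 + lc a x y (-h) ∈ Z :=
      add_mem_of_starEq_std (hst i' j') (mem_starSet_dn hmem)
    have hd : dist (lc a i' j' 0 + lc a x y (-h)) (lc a i j 0) ≤ 6 * a / 5 := by
      rw [dist_eq_norm, lc_add_lc, lc_sub_lc, zero_add, sub_zero, heq]
      exact norm_hole_le ha hh hw2 hE (Or.inr rfl)
    have hmem' := exists_of_starEq_std (hst i j) hr hd
    rw [lc_add_lc, lc_sub_lc, zero_add, sub_zero, heq] at hmem'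
    exact hclass_of_mem_starSet_dn ha.ne' hh (hκ i j) (hκ' i j) hmem'
  -- consistency of the upper class along u and v
  have hu : ∀ i j : ℤ, κ i j = κ (i + 1) j := by
    intro i j
    rcases hκ (i + 1) j with h1 | h1
    · rw [h1]
      refine ((transfer_up i j (i + 1) j (1 / 3 - 1) (1 / 3) 1 1 ?_ ?_ ?_).symm.trans (by decide))
      · rw [h1, mem_holes_iff]; right; left; rw [lc_eq_lc_iff ha.ne']; norm_num
      · rw [lc_eq_lc_iff ha.ne']; push_cast; exact ⟨by ring, by ring, rfl⟩
      · norm_num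
    · rw [h1]
      refine ((transfer_up i j (i + 1) j (-1 / 3) (-1 / 3) 2 (-1) ?_ ?_ ?_).symm.trans (by decide))
      · rw [h1, mem_holes_iff]; left; rw [lc_eq_lc_iff ha.ne']; norm_num
      · rw [lc_eq_lc_iff ha.ne']; push_cast; exact ⟨by ring, by ring, rfl⟩
      · norm_num
  have hv : ∀ i j : ℤ, κ i j = κ i (j + 1) := by
    intro i j
    rcases hκ i (j + 1) with h1 | h1
    · rw [h1]
      refine ((transfer_up i j i (j + 1) (1 / 3) (1 / 3 - 1) 1 1 ?_ ?_ ?_).symm.trans (by decide))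
      · rw [h1, mem_holes_iff]; right; right; rw [lc_eq_lc_iff ha.ne']; norm_num
      · rw [lc_eq_lc_iff ha.ne']; push_cast; exact ⟨by ring, by ring, rfl⟩
      · norm_num
    · rw [h1]
      refine ((transfer_up i j i (j + 1) (-1 / 3) (-1 / 3) (-1) 2 ?_ ?_ ?_).symm.trans (by decide))
      · rw [h1, mem_holes_iff]; left; rw [lc_eq_lc_iff ha.ne']; norm_num
      · rw [lc_eq_lc_iff ha.ne']; push_cast; exact ⟨by ring, by ring, rfl⟩
      · norm_num
  have hu' : ∀ i j : ℤ, κ' i j = κ' (i + 1) j := by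
    intro i j
    rcases hκ' (i + 1) j with h1 | h1
    · rw [h1]
      refine ((transfer_dn i j (i + 1) j (1 / 3 - 1) (1 / 3) 1 1 ?_ ?_ ?_).symm.trans (by decide))
      · rw [h1, mem_holes_iff]; right; left; rw [lc_eq_lc_iff ha.ne']; norm_num
      · rw [lc_eq_lc_iff ha.ne']; push_cast; exact ⟨by ring, by ring, rfl⟩
      · norm_num
    · rw [h1]
      refine ((transfer_dn i j (i + 1) j (-1 / 3) (-1 / 3) 2 (-1) ?_ ?_ ?_).symm.trans (by decide))
      · rw [h1, mem_holes_iff]; left; rw [lc_eq_lc_iff ha.ne']; norm_num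
      · rw [lc_eq_lc_iff ha.ne']; push_cast; exact ⟨by ring, by ring, rfl⟩
      · norm_num
  have hv' : ∀ i j : ℤ, κ' i j = κ' i (j + 1) := by
    intro i j
    rcases hκ' i (j + 1) with h1 | h1
    · rw [h1]
      refine ((transfer_dn i j i (j + 1) (1 / 3) (1 / 3 - 1) 1 1 ?_ ?_ ?_).symm.trans (by decide))
      · rw [h1, mem_holes_iff]; right; right; rw [lc_eq_lc_iff ha.ne']; norm_num
      · rw [lc_eq_lc_iff ha.ne']; push_cast; exact ⟨by ring, by ring, rfl⟩
      · norm_num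
    · rw [h1]
      refine ((transfer_dn i j i (j + 1) (-1 / 3) (-1 / 3) (-1) 2 ?_ ?_ ?_).symm.trans (by decide))
      · rw [h1, mem_holes_iff]; left; rw [lc_eq_lc_iff ha.ne']; norm_num
      · rw [lc_eq_lc_iff ha.ne']; push_cast; exact ⟨by ring, by ring, rfl⟩
      · norm_num
  -- globalise
  have glob : ∀ f : ℤ → ℤ → ℤ, (∀ i j, f i j = f (i + 1) j) → (∀ i j, f i j = f i (j + 1)) →
      ∀ i j, f i j = f 0 0 := by
    intro f hfu hfv
    have h1 : ∀ i j : ℤ, f i j = f i 0 := by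
      intro i j
      induction j using Int.induction_on with
      | zero => rfl
      | succ n ih => rw [← hfv, ih]
      | pred n ih => rw [← ih, hfv, sub_add_cancel]
    have h2 : ∀ i : ℤ, f i 0 = f 0 0 := by
      intro i
      induction i using Int.induction_on with
      | zero => rfl
      | succ n ih => rw [← hfu, ih]
      | pred n ih => rw [← ih, hfu, sub_add_cancel]
    intro i j
    rw [h1, h2]
  refine ⟨κ 0 0, κ' 0 0, hκ 0 0, hκ' 0 0, fun i j => ?_⟩
  rw [hst i j, glob κ hu hv i j, glob κ' hu' hv' i j]

/-- The two layers adjacent to a standardised layer. [folklore] -/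
theorem adjacent_layers {Z : Set E3} {τ τ' : ℤ}
    (hst : ∀ i j : ℤ, ((fun z => z - lc a i j 0) '' Z) ∩ closedBall 0 (6 * a / 5) =
      starSet a h τ τ') :
    (∀ i j : ℤ, lc a (i + τ / 3) (j + τ / 3) h ∈ Z) ∧
      (∀ i j : ℤ, lc a (i + τ' / 3) (j + τ' / 3) (-h) ∈ Z) := by
  constructor
  · intro i j
    have := add_mem_of_starEq_std (hst i j)
      (mem_starSet_up (by simp [holes] : lc a (τ / 3) (τ / 3) h ∈ holes a τ h))
    rwa [lc_add_lc, zero_add] at this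
  · intro i j
    have := add_mem_of_starEq_std (hst i j)
      (mem_starSet_dn (by simp [holes] : lc a (τ' / 3) (τ' / 3) (-h) ∈ holes a τ' (-h)))
    rwa [lc_add_lc, zero_add] at this

/-- **The slab**: with standard stars of classes `τ, τ'` at every lattice point, every point of `Z`
at height in `[-h, h]` lies in the base layer or in one of the two adjacent layers. [folklore] -/
theorem slab (ha : 0 < a) (hw1 : 0.775 * a < h) (hw2 : h < 0.894 * a) {Z : Set E3} {τ τ' : ℤ}
    (hτ : τ = 1 ∨ τ = -1) (hτ' : τ' = 1 ∨ τ' = -1)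
    (hst : ∀ i j : ℤ, ((fun z => z - lc a i j 0) '' Z) ∩ closedBall 0 (6 * a / 5) =
      starSet a h τ τ') {z : E3} (hz : z ∈ Z) (hzh : |z 2| ≤ h) :
    (∃ i j : ℤ, z = lc a i j 0) ∨ (∃ i j : ℤ, z = lc a (i + τ / 3) (j + τ / 3) h) ∨
      (∃ i j : ℤ, z = lc a (i + τ' / 3) (j + τ' / 3) (-h)) := by
  have hh : 0 < h := by linarith
  have hh2 : h ^ 2 ≤ 0.8 * a ^ 2 := by nlinarith
  obtain ⟨x, y, zz, rfl⟩ := exists_eq_lc ha.ne' z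
  simp only [lc_apply_two] at hzh
  obtain ⟨i, j, hij⟩ := exists_near_lattice x y
  have hd : dist (lc a x y zz) (lc a i j 0) ≤ 6 * a / 5 := by
    have hsq : dist (lc a x y zz) (lc a i j 0) ^ 2 ≤ (6 * a / 5) ^ 2 := by
      rw [dist_lc_sq, sub_zero]
      have hz2 : zz ^ 2 ≤ h ^ 2 := by
        rw [abs_le] at hzh; nlinarith
      nlinarith
    exact (pow_le_pow_iff_left₀ dist_nonneg (by positivity) two_ne_zero).1 hsq
  have hmem := exists_of_starEq_std (hst i j) hz hd
  rw [lc_sub_lc, sub_zero, mem_starSet_iff] at hmem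
  rcases hmem with e | e | e | e
  · left
    refine ⟨i, j, ?_⟩
    rw [← lc_zero a, lc_eq_lc_iff ha.ne'] at e
    rw [lc_eq_lc_iff ha.ne']
    exact ⟨by linarith [e.1], by linarith [e.2.1], e.2.2⟩
  · left
    obtain ⟨i₁, j₁, -, e⟩ := mem_hexagon_iff_num.1 e
    refine ⟨i + i₁, j + j₁, ?_⟩
    rw [lc_eq_lc_iff ha.ne'] at e ⊢
    push_cast
    exact ⟨by linarith [e.1], by linarith [e.2.1], e.2.2⟩
  · right; left
    obtain ⟨M, N, hMN, hcl, e⟩ := (mem_holes_iff_num ha.ne' hτ).1 e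
    obtain ⟨i₂, j₂, rfl, rfl⟩ := exists_numerators hτ hMN hcl
    refine ⟨i + i₂, j + j₂, ?_⟩
    rw [lc_eq_lc_iff ha.ne'] at e ⊢
    push_cast at e ⊢
    exact ⟨by linarith [e.1], by linarith [e.2.1], e.2.2⟩
  · right; right
    obtain ⟨M, N, hMN, hcl, e⟩ := (mem_holes_iff_num ha.ne' hτ').1 e
    obtain ⟨i₂, j₂, rfl, rfl⟩ := exists_numerators hτ' hMN hcl
    refine ⟨i + i₂, j + j₂, ?_⟩
    rw [lc_eq_lc_iff ha.ne'] at e ⊢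
    push_cast at e ⊢
    exact ⟨by linarith [e.1], by linarith [e.2.1], e.2.2⟩

end OneLayer

/-! ## Global assembly: occupied labelled layers, the Hägg sequence, the stacking -/

section Main

variable {a h : ℝ}

/-- Layer `k` with (integer) letter label `L` is fully occupied: `Λ₀ + L w + k h e₃ ⊆ Y`. [folklore] -/
def Occ (a h : ℝ) (Y : Set E3) (k L : ℤ) : Prop :=
  ∀ i j : ℤ, lc a (i + L / 3) (j + L / 3) (k * h) ∈ Y

/-- No two points of `Y` are at squared distance `a²/3` (a hole offset within a layer). [folklore] -/
theorem no_hole_offset (ha : 0 < a) (hh : 0 < h) {Y : Set E3} (hY : StarHyp a h Y) {y y' : E3}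
    (hy : y ∈ Y) (hy' : y' ∈ Y) (hn : ‖y' - y‖ ^ 2 = a ^ 2 / 3) : False := by
  obtain ⟨τ, τ', hτ, hτ', B, hstar⟩ := hY y hy
  have hd : dist y' y ≤ 6 * a / 5 := by
    rw [dist_eq_norm]
    have : ‖y' - y‖ ^ 2 ≤ (6 * a / 5) ^ 2 := by rw [hn]; nlinarith
    exact (pow_le_pow_iff_left₀ (norm_nonneg _) (by positivity) two_ne_zero).1 this
  obtain ⟨t, ht, hte⟩ := exists_of_starEq hstar hy' hd
  have htn : ‖t‖ ^ 2 = a ^ 2 / 3 := by rw [← B.norm_map, ← hte, hn]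
  rcases norm_sq_of_mem_starSet hτ hτ' ht with rfl | ⟨h1, -⟩ | h1
  · simp at htn; nlinarith
  · rw [htn] at h1; nlinarith
  · rw [htn] at h1; nlinarith

/-- **Uniqueness of the label mod 3** of an occupied layer. [folklore] -/
theorem occ_unique (ha : 0 < a) (hh : 0 < h) {Y : Set E3} (hY : StarHyp a h Y) {k L L' : ℤ}
    (hL : Occ a h Y k L) (hL' : Occ a h Y k L') : 3 ∣ L' - L := by
  have key : ∀ (i₀ j₀ : ℤ) (x y : ℝ), ((i₀ : ℝ) + L' / 3 - L / 3 = x) →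
      ((j₀ : ℝ) + L' / 3 - L / 3 = y) → x ^ 2 + x * y + y ^ 2 = 1 / 3 → False := by
    intro i₀ j₀ x y hx hy hE
    refine no_hole_offset ha hh hY (hL 0 0) (hL' i₀ j₀) ?_
    rw [lc_sub_lc, norm_lc_sq]
    push_cast
    simp only [zero_add]
    rw [hx, hy, hE]; ring
  have h3 : (L' - L) % 3 = 0 ∨ (L' - L) % 3 = 1 ∨ (L' - L) % 3 = 2 := by omega
  rcases h3 with h0 | h1 | h2
  · omega
  · exfalso
    obtain ⟨q, hq⟩ : ∃ q : ℤ, L' - L = 3 * q + 1 := ⟨(L' - L) / 3, by omega⟩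
    have hq' : (L' : ℝ) - L = 3 * q + 1 := by exact_mod_cast hq
    exact key (-q) (-q) (1 / 3) (1 / 3) (by push_cast; linarith) (by push_cast; linarith)
      (by norm_num)
  · exfalso
    obtain ⟨q, hq⟩ : ∃ q : ℤ, L' - L = 3 * q + 2 := ⟨(L' - L) / 3, by omega⟩
    have hq' : (L' : ℝ) - L = 3 * q + 2 := by exact_mod_cast hq
    exact key (-q - 1) (-q) (-1 / 3) (2 / 3) (by push_cast; linarith) (by push_cast; linarith)
      (by norm_num)

/-- **One step**: an occupied layer forces occupied neighbouring layers (labels shifted by `±1`)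
and exhausts the slab of height `h` around it. [folklore] -/
theorem occ_step (ha : 0 < a) (hw1 : 0.775 * a < h) (hw2 : h < 0.894 * a)
    (hne : h ^ 2 ≠ 2 * a ^ 2 / 3) {Y : Set E3} (hY : StarHyp a h Y) {k L : ℤ}
    (hocc : Occ a h Y k L) :
    (∃ τ : ℤ, (τ = 1 ∨ τ = -1) ∧ Occ a h Y (k + 1) (L + τ)) ∧
    (∃ τ' : ℤ, (τ' = 1 ∨ τ' = -1) ∧ Occ a h Y (k - 1) (L + τ')) ∧
    (∀ z ∈ Y, |z 2 - k * h| ≤ h → ∃ k' L' : ℤ, Occ a h Y k' L' ∧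
      ∃ i j : ℤ, z = lc a (i + L' / 3) (j + L' / 3) (k' * h)) := by
  have hh : 0 < h := by linarith
  obtain ⟨o, ho⟩ : ∃ o : E3, o = lc a (L / 3) (L / 3) (k * h) := ⟨_, rfl⟩
  obtain ⟨Z, hZdef⟩ : ∃ Z : Set E3, Z = (fun z => z - o) '' Y := ⟨_, rfl⟩
  have hZ : StarHyp a h Z := hZdef ▸ starHyp_translate hY o
  have hΛ : ∀ i j : ℤ, lc a i j 0 ∈ Z := by
    intro i j
    rw [hZdef]
    refine ⟨_, hocc i j, ?_⟩
    dsimp only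
    rw [ho, lc_sub_lc, lc_eq_lc_iff ha.ne']
    exact ⟨by ring, by ring, by ring⟩
  obtain ⟨τ, τ', hτ, hτ', hst⟩ := one_layer ha hw1 hw2 hne hZ hΛ
  obtain ⟨hup, hdn⟩ := adjacent_layers (h := h) hst
  -- back to `Y`
  have back : ∀ {x y zz : ℝ}, lc a x y zz ∈ Z →
      lc a (x + L / 3) (y + L / 3) (zz + k * h) ∈ Y := by
    intro x y zz hmem
    rw [hZdef] at hmem
    obtain ⟨w, hw, hwe⟩ := hmem
    dsimp only at hwe
    have : w = lc a (x + L / 3) (y + L / 3) (zz + k * h) := by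
      have : w = lc a x y zz + o := by rw [← hwe]; abel
      rw [this, ho, lc_add_lc]
    exact this ▸ hw
  refine ⟨⟨τ, hτ, fun i j => ?_⟩, ⟨τ', hτ', fun i j => ?_⟩, fun z hz hzh => ?_⟩
  · have := back (hup i j)
    convert this using 2 <;> push_cast <;> ring
  · have := back (hdn i j)
    convert this using 2 <;> push_cast <;> ring
  · have hzZ : z - o ∈ Z := by rw [hZdef]; exact ⟨z, hz, rfl⟩
    have h2 : |(z - o) 2| ≤ h := by
      have : (z - o) 2 = z 2 - k * h := by rw [ho]; simp
      rwa [this]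
    rcases slab ha hw1 hw2 hτ hτ' hst hzZ h2 with ⟨i, j, e⟩ | ⟨i, j, e⟩ | ⟨i, j, e⟩
    · refine ⟨k, L, hocc, i, j, ?_⟩
      have hz' : z = z - o + o := by abel
      rw [hz', e, ho, lc_add_lc, lc_eq_lc_iff ha.ne']
      exact ⟨by ring, by ring, by ring⟩
    · refine ⟨k + 1, L + τ, fun i' j' => ?_, i, j, ?_⟩
      · have := back (hup i' j')
        convert this using 2 <;> push_cast <;> ring
      · have hz' : z = z - o + o := by abel
        rw [hz', e, ho, lc_add_lc, lc_eq_lc_iff ha.ne']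
        push_cast
        exact ⟨by ring, by ring, by ring⟩
    · refine ⟨k - 1, L + τ', fun i' j' => ?_, i, j, ?_⟩
      · have := back (hdn i' j')
        convert this using 2 <;> push_cast <;> ring
      · have hz' : z = z - o + o := by abel
        rw [hz', e, ho, lc_add_lc, lc_eq_lc_iff ha.ne']
        push_cast
        exact ⟨by ring, by ring, by ring⟩

open Classical in
/-- The Hägg letter between layers `k` and `k + 1`, read off `Y`: `+1` iff some occupied label `L`
of layer `k` has `L + 1` occupied on layer `k + 1`. [folklore] -/
noncomputable def haggOf (a h : ℝ) (Y : Set E3) (k : ℤ) : ℤ :=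
  if ∃ L : ℤ, Occ a h Y k L ∧ Occ a h Y (k + 1) (L + 1) then 1 else -1

theorem haggOf_isHaggSeq (a h : ℝ) (Y : Set E3) : IsHaggSeq (haggOf a h Y) := by
  intro k
  unfold haggOf
  split_ifs <;> simp

/-- Going up one layer with the letter `haggOf`. [folklore] -/
theorem occ_up (ha : 0 < a) (hw1 : 0.775 * a < h) (hw2 : h < 0.894 * a)
    (hne : h ^ 2 ≠ 2 * a ^ 2 / 3) {Y : Set E3} (hY : StarHyp a h Y) {k L : ℤ}
    (hocc : Occ a h Y k L) : Occ a h Y (k + 1) (L + haggOf a h Y k) := by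
  have hh : 0 < h := by linarith
  obtain ⟨⟨τ, hτ, hτocc⟩, -, -⟩ := occ_step ha hw1 hw2 hne hY hocc
  unfold haggOf
  split_ifs with hex
  · obtain ⟨L', hL', hL'1⟩ := hex
    have h1 := occ_unique ha hh hY hocc hL'
    have h2 := occ_unique ha hh hY hτocc hL'1
    have : τ = 1 := by rcases hτ with rfl | rfl <;> omega
    rwa [this] at hτocc
  · have : τ = -1 := by
      rcases hτ with rfl | rfl
      · exact absurd ⟨L, hocc, hτocc⟩ hex
      · rfl
    rwa [this] at hτocc

/-- Going down one layer with the letter `haggOf`. [folklore] -/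
theorem occ_down (ha : 0 < a) (hw1 : 0.775 * a < h) (hw2 : h < 0.894 * a)
    (hne : h ^ 2 ≠ 2 * a ^ 2 / 3) {Y : Set E3} (hY : StarHyp a h Y) {k L₁ : ℤ}
    (hocc : Occ a h Y (k + 1) L₁) : Occ a h Y k (L₁ - haggOf a h Y k) := by
  have hh : 0 < h := by linarith
  obtain ⟨-, ⟨τ', hτ', hτ'occ⟩, -⟩ := occ_step ha hw1 hw2 hne hY hocc
  rw [add_sub_cancel_right] at hτ'occ
  have hup := occ_up ha hw1 hw2 hne hY hτ'occ
  have h1 := occ_unique ha hh hY hocc hup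
  have : haggOf a h Y k = -τ' := by
    rcases hτ' with rfl | rfl <;> rcases haggOf_isHaggSeq a h Y k with h2 | h2 <;>
      rw [h2] at h1 ⊢ <;> omega
  rw [this, sub_neg_eq_add]
  exact hτ'occ

/-- Every layer `k` is occupied with label `haggLabel (haggOf Y) k`. [folklore] -/
theorem occ_haggLabel (ha : 0 < a) (hw1 : 0.775 * a < h) (hw2 : h < 0.894 * a)
    (hne : h ^ 2 ≠ 2 * a ^ 2 / 3) {Y : Set E3} (hY : StarHyp a h Y) (h0 : Occ a h Y 0 0)
    (k : ℤ) : Occ a h Y k (haggLabel (haggOf a h Y) k) := by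
  induction k using Int.induction_on with
  | zero => simpa using h0
  | succ n ih =>
    rw [haggLabel_succ]
    exact occ_up ha hw1 hw2 hne hY ih
  | pred n ih =>
    have hrec := haggLabel_succ (haggOf a h Y) (-(n : ℤ) - 1)
    rw [sub_add_cancel] at hrec
    have := occ_down ha hw1 hw2 hne hY (k := -(n : ℤ) - 1)
      (L₁ := haggLabel (haggOf a h Y) (-(n : ℤ))) (by rw [sub_add_cancel]; exact ih)
    rw [hrec, add_sub_cancel_right] at this
    exact this

/-- **Core theorem**: a set with the local star property whose base layer is the full lattice is a
Barlow stacking. [folklore] -/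
theorem eq_barlowStacking (ha : 0 < a) (hw1 : 0.775 * a < h) (hw2 : h < 0.894 * a)
    (hne : h ^ 2 ≠ 2 * a ^ 2 / 3) {Y : Set E3} (hY : StarHyp a h Y)
    (hbase : ∀ i j : ℤ, lc a i j 0 ∈ Y) :
    ∃ s : ℤ → ℤ, IsHaggSeq s ∧ Y = barlowStacking a h s := by
  have hh : 0 < h := by linarith
  have h0 : Occ a h Y 0 0 := by
    intro i j; simpa using hbase i j
  refine ⟨haggOf a h Y, haggOf_isHaggSeq a h Y, ?_⟩
  have hocc := occ_haggLabel ha hw1 hw2 hne hY h0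
  ext z
  constructor
  · intro hz
    set k : ℤ := ⌊z 2 / h⌋ with hk
    have hk1 : (k : ℝ) * h ≤ z 2 := by
      have := Int.floor_le (z 2 / h)
      rw [← hk] at this
      rwa [le_div_iff₀ hh] at this
    have hk2 : z 2 < ((k : ℝ) + 1) * h := by
      have := Int.lt_floor_add_one (z 2 / h)
      rw [← hk] at this
      rwa [div_lt_iff₀ hh] at this
    have hzh : |z 2 - k * h| ≤ h := by
      rw [abs_le]; constructor <;> nlinarith
    obtain ⟨-, -, hslab⟩ := occ_step ha hw1 hw2 hne hY (hocc k)
    obtain ⟨k', L', hL', i, j, rfl⟩ := hslab z hz hzh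
    obtain ⟨q, hq⟩ := occ_unique ha hh hY (hocc k') hL'
    have hq' : (L' : ℝ) = haggLabel (haggOf a h Y) k' + 3 * q := by
      have : L' = haggLabel (haggOf a h Y) k' + 3 * q := by linarith
      exact_mod_cast this
    refine ⟨k', i + q, j + q, ?_⟩
    rw [barlowPos_eq_lc, lc_eq_lc_iff ha.ne', hq']
    push_cast
    exact ⟨by ring, by ring, by ring⟩
  · rintro ⟨k, i, j, rfl⟩
    rw [barlowPos_eq_lc]
    exact hocc k i j

/-- **`stub_layeringOffIdeal` — PROVED** (verbatim signature of the skeleton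
`Lines/c-layer-witness-strictness.lean`, Stub 5a): off the ideal ratio, a rooted set all of whose
`6a/5`-stars are linearly rotated Barlow 13-stars is one linearly rotated Barlow stacking.
[cite: HalesDSP2012 §1.3; ConwaySloane1999 Ch. 1 §1.3] -/
theorem stub_layeringOffIdeal_proof :
    ∀ (a h : ℝ), 0 < a → 0 < h → 0.775 * a < h → h < 0.894 * a → h ^ 2 ≠ 2 * a ^ 2 / 3 →
    ∀ Y : Set E3, (0 : E3) ∈ Y →
      (∀ y ∈ Y, ∃ s : ℤ → ℤ, IsHaggSeq s ∧ ∃ B : E3 →ₗᵢ[ℝ] E3,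
        ((fun z => z - y) '' Y) ∩ Metric.closedBall 0 (6 * a / 5) =
          B '' (barlowStacking a h s ∩ Metric.closedBall 0 (6 * a / 5))) →
      ∃ s : ℤ → ℤ, IsHaggSeq s ∧ ∃ A : E3 →ₗᵢ[ℝ] E3, Y = A '' barlowStacking a h s := by
  intro a h ha hh hw1 hw2 hne Y hY0 hloc
  have hY : StarHyp a h Y := starHyp_of_local ha hw1 hw2 hloc
  -- the star at the root, and the standardising isometry
  obtain ⟨τ₀, τ₀', hτ₀, hτ₀', B₀, h0⟩ := hY 0 hY0
  let C : E3 ≃ₗᵢ[ℝ] E3 := B₀.toLinearIsometryEquiv rfl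
  have hC : ∀ x, C x = B₀ x := fun x => rfl
  set Y' : Set E3 := C.symm '' Y with hY'def
  have hY' : StarHyp a h Y' := starHyp_image_equiv hY C.symm
  -- the star of `Y'` at `0` is standard
  have h0' : ((fun z => z - (0 : E3)) '' Y') ∩ closedBall 0 (6 * a / 5) =
      starSet a h τ₀ τ₀' := by
    have e1 : ((fun z => z - (0 : E3)) '' Y) = Y := by simp
    have e2 : ((fun z => z - (0 : E3)) '' Y') = Y' := by simp
    rw [e1] at h0
    rw [e2]
    ext z
    simp only [Set.mem_inter_iff, mem_closedBall_zero_iff, hY'def, Set.mem_image]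
    constructor
    · rintro ⟨⟨y, hy, rfl⟩, hn⟩
      have hyn : ‖y‖ ≤ 6 * a / 5 := by simpa using hn
      have : y ∈ Y ∩ closedBall 0 (6 * a / 5) := ⟨hy, mem_closedBall_zero_iff.2 hyn⟩
      rw [h0] at this
      obtain ⟨t, ht, rfl⟩ := this
      rw [← hC, C.symm_apply_apply]
      exact ht
    · intro hz
      have hBz : B₀ z ∈ Y ∩ closedBall 0 (6 * a / 5) := by rw [h0]; exact ⟨z, hz, rfl⟩
      refine ⟨⟨B₀ z, hBz.1, ?_⟩, ?_⟩
      · rw [← hC, C.symm_apply_apply]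
      · have := mem_closedBall_zero_iff.1 hBz.2
        rwa [B₀.norm_map] at this
  have hbase := base_layer ha hne hY' h0'
  obtain ⟨s, hs, hYs⟩ := eq_barlowStacking ha hw1 hw2 hne hY' (fun i j => (hbase i j).1)
  refine ⟨s, hs, B₀, ?_⟩
  have : Y = C '' Y' := by
    rw [hY'def, Set.image_image]; simp
  rw [this, hYs]
  ext z
  simp only [Set.mem_image, hC]

/-- The same statement over the skeleton's ambient abbreviation
`SlackRigidityNegative.E3` (definitionally `EuclideanSpace ℝ (Fin 3)`): this term can be pasted as
the proof of `CLayerWitnessStrictness.stub_layeringOffIdeal`. [folklore] -/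
theorem stub_layeringOffIdeal_proof' :
    ∀ (a h : ℝ), 0 < a → 0 < h → 0.775 * a < h → h < 0.894 * a → h ^ 2 ≠ 2 * a ^ 2 / 3 →
    ∀ Y : Set Summit.AtomisticToContinuum.Crystallization.Theorems.SlackRigidityNegative.E3,
      (0 : Summit.AtomisticToContinuum.Crystallization.Theorems.SlackRigidityNegative.E3) ∈ Y →
      (∀ y ∈ Y, ∃ s : ℤ → ℤ, IsHaggSeq s ∧
        ∃ B : Summit.AtomisticToContinuum.Crystallization.Theorems.SlackRigidityNegative.E3 →ₗᵢ[ℝ]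
          Summit.AtomisticToContinuum.Crystallization.Theorems.SlackRigidityNegative.E3,
        ((fun z => z - y) '' Y) ∩ Metric.closedBall 0 (6 * a / 5) =
          B '' (barlowStacking a h s ∩ Metric.closedBall 0 (6 * a / 5))) →
      ∃ s : ℤ → ℤ, IsHaggSeq s ∧
        ∃ A : Summit.AtomisticToContinuum.Crystallization.Theorems.SlackRigidityNegative.E3 →ₗᵢ[ℝ]
          Summit.AtomisticToContinuum.Crystallization.Theorems.SlackRigidityNegative.E3,
          Y = A '' barlowStacking a h s :=
  stub_layeringOffIdeal_proof

end Main

end Summit.AtomisticToContinuum.Crystallization.Cruxes.SlackRigidity.DrefuteLayering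

end
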